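import Literature.AlgebraicGeometry.ComplexMultiplication.CyclotomicFermatCMTypesBoundaryCaseOne
import Literature.AlgebraicGeometry.ComplexMultiplication.CyclotomicFermatCMTypesBoundaryCaseInstances
import HarnessLib

/-!
# Koblitz–Rohrlich §3 PROPOSITION, CASES 2 AND 3, at every level `N` prime to `6`, for boundary primes `p` with `p² ∣ N` or `p ≥ 11`
# (v3: or `p = 7`; hence IN FULL at every `N` prime to `30`): `H_τ = H_{τ′}` and `p ∣ r` force `r ∈ {r′, s′, t′}`; with a second
# boundary prime, `τ′` is a permutation of `τ` — and on abelian varieties the isogenies between the varieties of such boundary triples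
# are the obvious equalities (Theorem 1 (ii))

Layer `Literature/AlgebraicGeometry/ComplexMultiplication`, namespace `…ComplexMultiplication.CyclotomicFermatCMType`; sequel of
`CyclotomicFermatCMTypesBoundaryCaseOne` (this lane, gen 39: CASE 1 of the §3 Proposition at every `N` prime to `6`, and the level as an
invariant of `H`), whose honest column lists «Cases 2–3 (pp. 1195–1197: a prime dividing `N` and some but not all entries of ONE triple — the
"boundary" triples proper —, with K–R's omitted Lemma, the omitted "tedious examination" at `p = 5` and the hand check `N = 35`) are NOT
typed».  THIS FILE types CASES 2 AND 3 by Koblitz–Rohrlich's orbit-sum argument in the two regimes where the printed inequalities close by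
themselves — `ν = 0` (i.e. `p² ∣ N`) for every `p ≥ 5`, and `p ≥ 11` — and assembles the Proposition's conclusion "`τ′` is a permutation of
`τ`" in those regimes; v2 adds Case 3's printed sub-case "`p = 7` and `a ≥ 7`", the printed hypothesis "g.c.d.`(r, s, t, r′, s′, t′) = 1`"
(Case 1 ⟹ both triples primitive), the form at levels whose primes `< 11` occur squared, and THEOREM 1 (ii) for such boundary triples on
abelian varieties; v3 completes `p = 7`: Case 3 at `p = 7` in full (K–R's re-dispatch "`p = 7, a = 5`" and `N = 35` through the tree's
enumeration), Case 2 for every `p ≥ 7` off the residue class `r ≡ r′ (mod N/5)` (a unit with `⟨u(r − r′)⟩` just below `N/2` in place of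
K–R's omitted Lemma), and hence THE PROPOSITION IN FULL AT EVERY LEVEL `N` PRIME TO `30`.  THEOREMS ONLY (no definition, no named fact,
no `sorry`; no kernel `decide` in this file — `N = 35` is imported from `CyclotomicFermatCMTypesBoundaryCaseInstances`).

THE SOURCE.  N. Koblitz, D. Rohrlich, *Simple factors in the Jacobian of a Fermat curve*, Canad. J. Math. **30** (1978) 1183–1205 (held
`paper:koblitz1978-simple-factors-jacobian-fermat-curve`, pp. 1193–1197 read first-hand).  §3 (p. 1193): "PROPOSITION. Let `2, 3 ∤ N`,
`τ = (r, s, t)`, `τ′ = (r′, s′, t′)`, `r + s + t = N`. Suppose g.c.d.`(r, s, t, r′, s′, t′) = 1`. Let `H_τ = {h ∈ (ℤ/Nℤ)* | ⟨hr⟩ + ⟨hs⟩ + ⟨ht⟩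
= N}` and similarly for `H_{τ′}`. Suppose `N` is not prime to `rstr′s′t′`. In the case that `r = r′` for some ordering of the triples `τ` and
`τ′`, suppose further that `N` is not prime to `sts′t′`. Finally, suppose `H_τ = H_{τ′}`. Then `τ′` is a permutation of `τ`."  (p. 1195:)
"Case 2. There exists a prime `p` dividing `N, r, r′` but not dividing `sts′t′`; and `r ≠ r′`.  We need the following simple lemma, whose proof
is straightforward and will be omitted. LEMMA. … Let `P, P*, p, r₀′, s₀′, t₀′` be defined as before, `r₀ = ⟨r⟩_{N/p}, s₀ = ⟨s⟩_{N/p}, t₀ =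
⟨t⟩_{N/p}`. Since `H_τ = H_{τ′}`, for `u ∈ P*` we have `⟨ur⟩ + ⟨us⟩ + ⟨ut⟩ = ⟨ur′⟩ + ⟨us′⟩ + ⟨ut′⟩`. For `u ∈ P∖P*` we have `|⟨ur⟩ + ⟨us⟩ +
⟨ut⟩ − ⟨ur′⟩ − ⟨us′⟩ − ⟨ut′⟩| ≤ N`. Thus (5) `νN ≥ |Σ_{u∈P} ⟨ur⟩ + ⟨us⟩ + ⟨ut⟩ − Σ_{u∈P} ⟨ur′⟩ + ⟨us′⟩ + ⟨ut′⟩| = p|r + s₀ + t₀ − r′ − s₀′ −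
t₀′|` … "First suppose `p > 5`, or `p = 5` and `5² | N` (so that `ν = 0`). By the lemma applied with `x = r, y = r′`, if we multiply through
by a suitable `u ∈ (ℤ/Nℤ)*`, without loss of generality we may assume that `|⌊r/(N/p)⌋ − ⌊r′/(N/p)⌋| ≥ ν + 2`, which contradicts (6)."  (p. 1196:)
"Now suppose `N = 5N₀, 5 ∤ N₀, 5 | r, r′` … [a page of special analysis] … Case 3. There exists a prime `p | N, r`, `p ∤ str′s′t′`.
Multiplying through by a suitable element of `(ℤ/Nℤ)*`, without loss of generality we may assume that `r = g.c.d.(N, r)`. … `νN ≥ Σ_{u∈P}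
⟨ur⟩ + ⟨us⟩ + ⟨ut⟩ − Σ_{u∈P} ⟨ur′⟩ + ⟨us′⟩ + ⟨ut′⟩ = pr + Σ_{i=0}^{p−1} (s₀ + iN/p + t₀ + iN/p − r₀′ − iN/p − s₀′ − iN/p − t₀′ − iN/p)`" (p. 1197:)
"Hence (8) `νN/p ≥ (p−3)/2·N/p + r₀′ + s₀′ + t₀′ − r − s₀ − t₀ ≥ (p−3)/2·N/p + N/p − 2N/p − r`, (9) … Let `a = N/r ≥ 5`. If `p ≥ 11`, (9)
implies `0 < p/a − p/2 + 5/2 ≤ 5/2 − 3p/10 < 0`, a contradiction. If `p = 7` and `a ≥ 7` … It remains to consider the case `p = 7, a = 5`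
and the case `p = 5`. Note that when `ν = 0`, (9) gives `0 < p/a − p/2 + 3/2 ≤ 0` for all `a ≥ 5, p ≥ 5`. So suppose `p² ∤ N`. … The only
remaining case when `p = 7, a = 5, 7² ∤ N` is when `r = 7`, i.e., `N = 35`; this case is easily checked by hand. … [p = 5:] By a tedious
examination of possible ranges of values for `r′, s′, t′`, we verified that no `τ′ ≠ τ` has `H_{τ′}` given by (10). This part of the proof
will be omitted in the interest of brevity.  This completes the proof of Case 3 of the proposition, and hence of Theorem 1."

## What is proved (level written `N = pQ`; "`p ∣ x`" for a residue `x` means `p ∣ ⟨x⟩`, the representative in `[0, N)`)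

* §1 **`exists_isUnit_val_mul_eq_gcd`** ("we may assume that `r = g.c.d.(N, r)`": for `x ≠ 0` a unit `u` with `⟨ux⟩ = g.c.d.(⟨x⟩, N)`, any
  `N`; unit lifting `(ℤ/N)ˣ ↠ (ℤ/y)ˣ` is Mathlib's `ZMod.unitsMap_surjective`) and **`five_mul_gcd_val_le`** ("`a = N/r ≥ 5`": `5·g.c.d. ≤ N`
  for `N` prime to `6`).
* §2 **`orbit_sum_compare`** — inequality (5) in exact form: for `H_τ = H_{τ′}`, `τ, τ′` admissible and primitive, and any unit `h₀`, the orbit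
  sums `Σ_{u ∈ h₀P} ⟨ur⟩ + ⟨us⟩ + ⟨ut⟩` and `Σ_{u ∈ h₀P} ⟨ur′⟩ + ⟨us′⟩ + ⟨ut′⟩` (`P = 1 + Q·ℤ/p`) differ by `E − E′`, the contributions of the
  `ν ≤ 1` non-unit points, with EITHER `E = E′ = 0` OR `N ≤ E, E′ ≤ 2N`, and `E = E′ = 0` when `p ∣ Q` (K–R's "`= N` or `2N` on `P∖P*`"
  needs primitivity — a non-unit point with all three representatives divisible by `Q` would contribute `0`; this is where "g.c.d. = 1 after
  Case 1" enters).
* §3 **`fermatCMType_ne_of_dvd_of_not_dvd_of_sq_dvd_or_le`** = CASE 3 in the regimes: `N = pQ` prime to `6`, `p ≥ 5` prime, `p ∣ Q` or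
  `p ≥ 11`; `τ, τ′` admissible and primitive; `p ∣ r`, `p ∤ r′, s′, t′` ⟹ `H_τ ≠ H_{τ′}` (orbit sums over `h₀P` with `⟨h₀r⟩ = g.c.d.(N, r)`:
  `2Σ_τ = 2p·r + 2p(s₀ + t₀) + 2(p−1)N`, `2Σ_{τ′} = 2p(r₀′ + s₀′ + t₀′) + 3(p−1)N`, `s₀ + t₀ ≤ 2N/p − 2`, `r₀′ + s₀′ + t₀′ ≥ N/p`, `5r ≤ N`);
  (v2) **`fermatCMType_ne_of_dvd_of_not_dvd_of_sq_dvd_or_le_or_gcd`** adds the printed sub-case "`p = 7` and `a ≥ 7`" (`p ≥ 7` and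
  `7·g.c.d.(N, r) ≤ N`, any `ν`).
* §4 **`eq_of_fermatCMType_eq_of_dvd_of_dvd_of_sq_dvd_or_le`** = CASE 2 in the regimes: same setting, `p ∣ r, r′`, `H_τ = H_{τ′}` ⟹ `r = r′`.
  K–R's omitted LEMMA (a unit `u` with `⌊⟨ur⟩/(N/p)⌋` and `⌊⟨ur′⟩/(N/p)⌋` at distance `≥ ν + 2`) is REPLACED by the Case-1 unit: `u` with
  `2N/5 ≤ ⟨u(r − r′)⟩ ≤ 3N/5` (sibling `exists_isUnit_val_mul_mem_middle`), which separates `p⟨ur⟩` from `p⟨ur′⟩` by more than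
  `|Σ_{uτ} − Σ_{uτ′}| + (slack)` exactly when `ν = 0` (any `p ≥ 5`) or `p ≥ 11`.
* §5 **`eq_or_eq_or_eq_of_fermatCMType_eq_of_dvd`** (Cases 2 + 3: `p ∣ r` ⟹ `r = r′ ∨ r = s′ ∨ r = t′`), **`multiset_eq_of_fermatCMType_eq_of_eq_of_dvd`**
  (the matched form: `r = r′` and the regime prime dividing `s` ⟹ `{r, s, t} = {r′, s′, t′}`), their general-level forms `…_level` (`p ∣ N`,
  `p·p ∣ N ∨ 11 ≤ p`), and **`multiset_eq_of_fermatCMType_eq_of_dvd_of_dvd`** — THE PROPOSITION IN THE REGIMES: at `N` prime to `6`, for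
  admissible primitive `τ, τ′` with `H_τ = H_{τ′}`, a regime prime `p ∣ N` dividing `r` and a regime prime `q ∣ N` dividing `s` or `t` give
  `{r, s, t} = {r′, s′, t′}`.
* §6 (v2) **`isIsogenous_iff_exists_unit_multiset_eq_of_dvd_of_dvd`** — THEOREM 1 (ii) FOR SUCH BOUNDARY TRIPLES, ON ABELIAN VARIETIES:
  realisations `A`, `A′` of the full-level types `Φ_{H_τ}`, `Φ_{H_{τ′}}` of `ℚ(ζ_N)` (`τ, τ′` admissible primitive, a regime prime dividing `r`,
  a regime prime dividing `s` or `t`) are ISOGENOUS iff `{r′, s′, t′} = {ur, us, ut}` for a unit `u` — "the only isogenies are the obvious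
  equalities" (Shimura–Taniyama `A ∼ A′ ⟺ H_{τ′} = H_{uτ}`, tree `isIsogenous_fermatCMType_iff_exists_eq_mul`, + §5 for `uτ`).
* §7 (v2) **`primitive_of_fermatCMType_eq_of_gcd_six`** (the printed hypothesis "g.c.d.`(r, s, t, r′, s′, t′) = 1`", read on the primes of
  `N`, makes both triples primitive under `H_τ = H_{τ′}` — Case 1, sibling `dvd_iff_dvd_of_fermatCMType_eq_of_prime_dvd`),
  **`multiset_eq_of_fermatCMType_eq_of_gcd_six`** (the Proposition with its printed hypotheses, regime primes), and
  **`multiset_eq_of_fermatCMType_eq_of_sq_dvd_of_lt`** (at levels `N` prime to `6` in which every prime `< 11` occurs squared, EVERY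
  boundary prime is in a regime: the Proposition holds there with no regime clause).
* §8 (v3) **`fermatCMType_ne_of_seven_dvd_of_not_dvd`** (+ `_level`) — CASE 3 AT `p = 7` IN FULL at every `N = 7Q` prime to `6`: with
  `a = N/g.c.d.(N, r)`, `a ≥ 7` is §3; at `a = 5` K–R's re-dispatch (p. 1197) — a prime `q ≥ 11` of the g.c.d., or `5` (then `5² ∣ N`),
  puts `r` among `r′, s′, t′` by §5, contradicting `7 ∤ r′s′t′`; `7² ∣ N` is `ν = 0`; the last case `N = 35` ("easily checked by hand")
  is the tree's kernel enumeration `multiset_eq_of_fermatCMType_eq_thirtyFive` (gen 36; `τ′` has a unit entry by primitivity).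
* §9 (v3) **`exists_isUnit_val_mul_near_half`** (for `N` prime to `6`, `x ≠ 0`, `N ≠ 5·g.c.d.(⟨x⟩, N)`: a unit `u` with `⟨ux⟩ =
  ((y−1)/2)(N/y)`, so `3N/7 ≤ ⟨ux⟩ ≤ N/2`) and **`eq_of_fermatCMType_eq_of_dvd_of_dvd_of_seven_le`** — CASE 2 FOR EVERY `p ≥ 7`, ANY `ν`,
  provided `N ≠ 5·g.c.d.(⟨r − r′⟩, N)` (automatic when `5 ∤ N`).
* §10 (v3) AT EVERY LEVEL `N` PRIME TO `30` (all primes of `N` are `≥ 7`; no regime clause): **`eq_or_eq_or_eq_of_fermatCMType_eq_of_dvd_coprime_thirty`**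
  (+ `_level`; `p ∣ r` ⟹ `r ∈ {r′, s′, t′}`), `multiset_eq_of_fermatCMType_eq_of_eq_of_dvd_coprime_thirty_level`,
  **`multiset_eq_of_fermatCMType_eq_of_dvd_of_dvd_coprime_thirty`** (THE PROPOSITION: primitive admissible `τ, τ′`, `H_τ = H_{τ′}`, a prime
  of `N` dividing `r`, a prime of `N` dividing `s` or `t` ⟹ `{r, s, t} = {r′, s′, t′}`), **`multiset_eq_of_fermatCMType_eq_of_gcd_six_coprime_thirty`**
  (printed hypotheses) and **`isIsogenous_iff_exists_unit_multiset_eq_coprime_thirty`** (THEOREM 1 (ii) for such boundary triples on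
  abelian varieties).

## Honest column / NOT here

* Boundary primes covered: `p² ∣ N` or `p ≥ 11` (§§3–5), and `p = 7` (§§8–10: Case 3 always, Case 2 off the class `r ≡ r′ (mod N/5)`) —
  hence EVERYTHING at levels prime to `30`.  NOT typed: `p = 5` with `5² ∤ N` (K–R's Case 2 sub-case "`N = 5N₀, 5 ∤ N₀, 5 | r, r′`",
  p. 1196, and Case 3's omitted "tedious examination" with (10), p. 1197), and at `p = 7` the Case-2 residue class `r ≡ r′ (mod N/5)`
  when `5 ∣ N`, `7² ∤ N`; K–R's omitted Lemma itself (floor-separation `≥ ν + 2`) is not typed — our units (`2N/5 ≤ ⟨ud⟩ ≤ 3N/5` from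
  Case 1, `⟨ud⟩ = ((y−1)/2)(N/y)` here) are a different, shorter road.  Consequently THEOREM 1 (i) at composite `N` is still NOT assembled
  in the tree beyond prime powers (gen 37) and `N = 35` (gen 36): missing are the levels divisible by `5` (to the first power) at `p = 5`,
  and the junction with §2 (the relatively prime case at composite `N`, typed for two-prime levels in gens 35–36 only; and the configuration
  "`r = r′` non-unit, `s, t, s′, t′` units", which K–R's Proposition excludes by hypothesis).
* "`τ, τ′` primitive" (no prime of `N` divides all of `⟨r⟩, ⟨s⟩, ⟨t⟩`) is K–R's normalisation g.c.d.`(r, s, t, r′, s′, t′) = 1` AFTER Case 1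
  (sibling `not_dvd_of_fermatCMType_eq`: under `H_τ = H_{τ′}` a prime dividing one whole triple divides the other); it is assumed, not
  re-derived, here.  "`p ∣ x`" is read on representatives; the regime "`p² ∣ N`" is written `p ∣ Q` at `N = pQ` (`p·p ∣ N` in the `_level`
  forms).  The second boundary prime is taken to divide `s` or `t`; the variant where it divides the two unmatched entries of `τ′` is the
  same theorem with `τ, τ′` exchanged (K–R: "for some ordering of the triples").
* The argument is K–R's (orbit sums over `P`-cosets, (5)–(6), (8)–(9)), reorganised as in the sibling around a free unit `h₀` so that the
  non-unit point's contribution is carried exactly (`E, E′`) instead of through `ν`; the inequalities are closed by `linarith` from the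
  printed bounds.  Nothing is computed by `decide`; no character sums.

## References

* [KoblitzRohrlich1978] N. Koblitz, D. Rohrlich, Canad. J. Math. 30 (1978) 1183–1205: Theorem 1 (p. 1185), §3 Proposition (p. 1193),
  Case 2 and the Lemma (pp. 1195–1196), Case 3 (pp. 1196–1197).
* [Shimura1998] G. Shimura, *Abelian Varieties with Complex Multiplication and Modular Functions* (1998), §6.1 Corollary, §8.4 Example (1)
  (through `CyclotomicFermatCMTypesPrimePowerIsogenies.isIsogenous_fermatCMType_iff_exists_eq_mul`).

## Provenance

Cell `pub-hodgecm2` (COR-CM), literature seat `lit-deligne-3` gen 39 (claim KR78-BOUNDARY-CASES23; count-neutral, own lane).  HC_CM is NOT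
proved and nothing here bears on it.
-/

namespace Literature.AlgebraicGeometry.ComplexMultiplication

open Literature.AlgebraicGeometry.HodgeTheory (fermatCMType)
open Finset

namespace CyclotomicFermatCMType

/-! ## §1 Tools: the minimal representative `⟨hx⟩ = g.c.d.(x, N)`; the orbit sums of `τ` and `τ′` differ by at most `νN` -/

section Tools

variable {N : ℕ} [NeZero N]

/-- A residue is a unit iff its representative is prime to the modulus. [folklore] -/
private theorem isUnit_iff_val_coprime_bt {m : ℕ} [NeZero m] (x : ZMod m) : IsUnit x ↔ x.val.Coprime m := by
  conv_lhs => rw [← ZMod.natCast_zmod_val x]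
  exact ZMod.isUnit_iff_coprime x.val m

/-- Membership in `H_{(a,b,c)}` (unfolding the tree's `fermatCMType`). [cite: KoblitzRohrlich1978, §1 (p. 1184)] -/
private theorem mem_fermatCMType_iff_bt {m : ℕ} [NeZero m] (a b c x : ZMod m) :
    x ∈ fermatCMType m a b c ↔ x.val.Coprime m ∧ (x * a).val + (x * b).val + (x * c).val = m := by
  simp only [fermatCMType, mem_filter, mem_univ, true_and]

/-- For a triple with `a + b + c = 0` and any multiplier `h`: `⟨ha⟩ + ⟨hb⟩ + ⟨hc⟩ = k·m`, `k ≤ 2`. [cite: KoblitzRohrlich1978, §1 (p. 1184)] -/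
private theorem exists_val_sum_eq_mul_bt {m : ℕ} [NeZero m] {a b c : ZMod m} (habc : a + b + c = 0) (h : ZMod m) :
    ∃ k, k ≤ 2 ∧ (h * a).val + (h * b).val + (h * c).val = k * m := by
  have hsum0 : (((h * a).val + (h * b).val + (h * c).val : ℕ) : ZMod m) = 0 := by
    push_cast
    rw [ZMod.natCast_zmod_val, ZMod.natCast_zmod_val, ZMod.natCast_zmod_val, ← mul_add, ← mul_add, habc, mul_zero]
  obtain ⟨k, hk⟩ := (ZMod.natCast_eq_zero_iff _ _).mp hsum0
  have hxlt := ZMod.val_lt (h * a)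
  have hylt := ZMod.val_lt (h * b)
  have hzlt := ZMod.val_lt (h * c)
  refine ⟨k, ?_, by rw [hk, mul_comm]⟩
  by_contra hk3
  push Not at hk3
  have := Nat.mul_le_mul_left m hk3
  omega

/-- **The minimal representative**: for every residue `x` there is a UNIT `u` with `⟨ux⟩ = g.c.d.(⟨x⟩, N)` ("Multiplying through by a suitable
element of `(ℤ/Nℤ)*`, without loss of generality we may assume that `r = g.c.d.(N, r)`"). [cite: KoblitzRohrlich1978, §3 Case 3 (p. 1196)] -/
theorem exists_isUnit_val_mul_eq_gcd {x : ZMod N} (hx : x ≠ 0) : ∃ u : ZMod N, IsUnit u ∧ (u * x).val = Nat.gcd x.val N := by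
  have hN0 : 0 < N := Nat.pos_of_ne_zero (NeZero.ne N)
  set a := x.val with ha
  have ha0 : a ≠ 0 := fun h => hx ((ZMod.val_eq_zero x).1 h)
  have ha0' : 0 < a := Nat.pos_of_ne_zero ha0
  set g := Nat.gcd a N with hg
  have hg0 : 0 < g := Nat.gcd_pos_of_pos_left N ha0'
  obtain ⟨y, hyN⟩ : g ∣ N := Nat.gcd_dvd_right a N
  obtain ⟨a₁, ha₁⟩ : g ∣ a := Nat.gcd_dvd_left a N
  have hy0 : 0 < y := Nat.pos_of_ne_zero fun h => by rw [h, mul_zero] at hyN; omega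
  have hcop : Nat.Coprime a₁ y := by
    have h := Nat.coprime_div_gcd_div_gcd (m := a) (n := N) hg0
    rw [← hg] at h
    have e1 : a / g = a₁ := by rw [ha₁, Nat.mul_div_cancel_left _ hg0]
    have e2 : N / g = y := by rw [hyN, Nat.mul_div_cancel_left _ hg0]
    rwa [e1, e2] at h
  haveI : NeZero y := ⟨hy0.ne'⟩
  have hyd : y ∣ N := ⟨g, by rw [hyN, mul_comm]⟩
  obtain ⟨U, hU⟩ := ZMod.unitsMap_surjective hyd (ZMod.unitOfCoprime a₁ hcop)⁻¹
  have hUv : ZMod.castHom hyd (ZMod y) (U : ZMod N) = ((ZMod.unitOfCoprime a₁ hcop)⁻¹ : (ZMod y)ˣ) := by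
    rw [← hU]; rfl
  have hva : (((ZMod.unitOfCoprime a₁ hcop)⁻¹ : (ZMod y)ˣ) : ZMod y) * (a₁ : ZMod y) = 1 := by
    rw [← ZMod.coe_unitOfCoprime a₁ hcop, Units.inv_mul]
  have hmod : (U : ZMod N).val * a₁ ≡ 1 [MOD y] := by
    rw [← ZMod.natCast_eq_natCast_iff, Nat.cast_mul, Nat.cast_one, ← hva, ← hUv, ZMod.castHom_apply, ZMod.cast_eq_val]
  have hUx : (U : ZMod N) * x = ((g : ℕ) : ZMod N) := by
    have e : (U : ZMod N) * x = (((U : ZMod N).val * a : ℕ) : ZMod N) := by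
      rw [Nat.cast_mul, ZMod.natCast_zmod_val, ha, ZMod.natCast_zmod_val]
    rw [e, ZMod.natCast_eq_natCast_iff, ha₁]
    have := Nat.ModEq.mul_left' g hmod
    rw [← mul_assoc, mul_comm g ((U : ZMod N).val), mul_assoc, mul_one, ← hyN] at this
    exact this
  refine ⟨U, U.isUnit, ?_⟩
  rw [hUx, ZMod.val_natCast, Nat.mod_eq_of_lt]
  calc g ≤ a := Nat.le_of_dvd ha0' (Nat.gcd_dvd_left a N)
    _ < N := ZMod.val_lt x

/-- For `N` prime to `6` and `x ≠ 0`: `5·g.c.d.(⟨x⟩, N) ≤ N` (`N/g.c.d. > 1` is prime to `6`, hence `≥ 5`: "Let `a = N/r ≥ 5`").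
[cite: KoblitzRohrlich1978, §3 Case 3 (p. 1197)] -/
theorem five_mul_gcd_val_le (hN2 : Nat.Coprime 2 N) (hN3 : Nat.Coprime 3 N) {x : ZMod N} (hx : x ≠ 0) :
    5 * Nat.gcd x.val N ≤ N := by
  have ha0 : 0 < x.val := Nat.pos_of_ne_zero fun h => hx ((ZMod.val_eq_zero x).1 h)
  set g := Nat.gcd x.val N with hg
  have hg0 : 0 < g := Nat.gcd_pos_of_pos_left N ha0
  obtain ⟨y, hyN⟩ : g ∣ N := Nat.gcd_dvd_right x.val N
  have hy1 : y ≠ 1 := by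
    intro h1; rw [h1, mul_one] at hyN
    have : g ≤ x.val := Nat.le_of_dvd ha0 (Nat.gcd_dvd_left x.val N)
    have := ZMod.val_lt x
    omega
  have hy0 : y ≠ 0 := fun h => NeZero.ne N (by rw [hyN, h, mul_zero])
  have hy2 : Nat.Coprime 2 y := Nat.Coprime.coprime_dvd_right ⟨g, by rw [hyN, mul_comm]⟩ hN2
  have hy3 : Nat.Coprime 3 y := Nat.Coprime.coprime_dvd_right ⟨g, by rw [hyN, mul_comm]⟩ hN3
  have hy5 : 5 ≤ y := by
    have h2 : ¬2 ∣ y := fun h => by have := Nat.Coprime.eq_one_of_dvd hy2 h; omega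
    have h3 : ¬3 ∣ y := fun h => by have := Nat.Coprime.eq_one_of_dvd hy3 h; omega
    omega
  rw [hyN]
  nlinarith

end Tools

/-! ## §2 Comparing the orbit sums of `τ` and `τ′`: `|Σ_{u∈h₀P} S_τ(u) − Σ_{u∈h₀P} S_{τ′}(u)| ≤ νN` -/

section Compare

variable {p Q : ℕ} [NeZero (p * Q)]

/-- `p ∤ ⟨x⟩`, `h` a unit ⟹ `p ∤ ⟨hx⟩` modulo `N = pQ`. [folklore] -/
private theorem not_dvd_val_mul_bt (hp : p.Prime) {h : ZMod (p * Q)} (hh : IsUnit h) (x : ZMod (p * Q))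
    (hx : ¬p ∣ x.val) : ¬p ∣ (h * x).val := by
  intro hd
  rw [ZMod.val_mul, Nat.dvd_mod_iff (dvd_mul_right p Q)] at hd
  rcases (Nat.Prime.dvd_mul hp).1 hd with h1 | h1
  · have hc := (isUnit_iff_val_coprime_bt h).1 hh
    exact (Nat.Prime.coprime_iff_not_dvd hp).1 (Nat.Coprime.coprime_dvd_right (dvd_mul_right p Q) hc).symm h1
  · exact hx h1

/-- `d ∣ N`, `d ∣ ⟨hx⟩`, `h` a unit ⟹ `d ∣ ⟨x⟩`. [folklore] -/
private theorem dvd_val_of_dvd_val_mul {m d : ℕ} [NeZero m] (hd : d ∣ m) {h : ZMod m} (hh : IsUnit h) {x : ZMod m}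
    (hx : d ∣ (h * x).val) : d ∣ x.val := by
  rw [ZMod.val_mul, Nat.dvd_mod_iff hd] at hx
  have hc : Nat.Coprime d h.val := (Nat.Coprime.coprime_dvd_right hd ((isUnit_iff_val_coprime_bt h).1 hh)).symm
  exact hc.dvd_of_dvd_mul_left hx

omit [NeZero (p * Q)] in
/-- **Primitivity at `Q`**: if no prime of `N = pQ` divides all of `⟨r⟩, ⟨s⟩, ⟨t⟩` and `Q ≥ 2`, then `Q` does not divide all three
(the normalisation `M = N`, "g.c.d.`(N, r, s, t) = 1`"). [cite: KoblitzRohrlich1978, §2 (p. 1187) and §3 (p. 1193)] -/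
private theorem not_dvd_three_of_primitive {r s t : ZMod (p * Q)}
    (hprim : ∀ q : ℕ, q.Prime → q ∣ p * Q → ¬(q ∣ r.val ∧ q ∣ s.val ∧ q ∣ t.val)) (hQ : 2 ≤ Q) :
    ¬(Q ∣ r.val ∧ Q ∣ s.val ∧ Q ∣ t.val) := by
  rintro ⟨hr, hs, ht⟩
  obtain ⟨q, hq, hqQ⟩ := Nat.exists_prime_and_dvd (by omega : Q ≠ 1)
  exact hprim q hq (dvd_trans hqQ (dvd_mul_left Q p)) ⟨dvd_trans hqQ hr, dvd_trans hqQ hs, dvd_trans hqQ ht⟩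

/-- A non-unit orbit point `u* = h₀(1 + i₀Q)` with `⟨u*x⟩ = 0` forces `Q ∣ ⟨x⟩` (`p ∣ 1 + i₀Q` is not even needed: `gcd(1 + i₀Q, Q) = 1`).
[cite: KoblitzRohrlich1978, §3 Case 1 (p. 1194)] -/
private theorem dvd_val_of_orbit_mul_val_eq_zero {h₀ : ZMod (p * Q)} (hh₀ : IsUnit h₀) {i : ℕ} {x : ZMod (p * Q)}
    (h0 : (h₀ * (1 + (i : ZMod (p * Q)) * (Q : ZMod (p * Q))) * x).val = 0) : Q ∣ x.val := by
  rw [ZMod.val_eq_zero, mul_assoc] at h0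
  have h1 : (1 + (i : ZMod (p * Q)) * (Q : ZMod (p * Q))) * x = 0 := (hh₀.mul_right_eq_zero).1 h0
  have e : (1 + (i : ZMod (p * Q)) * (Q : ZMod (p * Q))) * x = (((1 + i * Q) * x.val : ℕ) : ZMod (p * Q)) := by
    push_cast; rw [ZMod.natCast_zmod_val]
  rw [e, ZMod.natCast_eq_zero_iff] at h1
  have h2 : Q ∣ (1 + i * Q) * x.val := dvd_trans (dvd_mul_left Q p) h1
  exact ((Nat.coprime_add_mul_right_left 1 Q i).2 (Nat.coprime_one_left Q)).symm.dvd_of_dvd_mul_left h2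

/-- **The orbit sums of `τ` and `τ′` over `h₀P` agree up to the non-unit point** ("for `u ∈ P*` we have `⟨ur⟩ + ⟨us⟩ + ⟨ut⟩ = ⟨ur′⟩ + ⟨us′⟩ +
⟨ut′⟩`. For `u ∈ P∖P*` we have `|⟨ur⟩ + ⟨us⟩ + ⟨ut⟩ − ⟨ur′⟩ − ⟨us′⟩ − ⟨ut′⟩| ≤ N`"): for `H_τ = H_{τ′}`, both triples admissible and
primitive (no prime of `N` divides all three representatives) and a unit `h₀`, there are `E, E′` (the contributions of the `ν ≤ 1` non-unit
points to the two orbit sums) with `Σ_{u ∈ h₀P} S_τ(u) + E′ = Σ_{u ∈ h₀P} S_{τ′}(u) + E`, where EITHER `E = E′ = 0` OR `N ≤ E, E′ ≤ 2N`; and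
`E = E′ = 0` when `p ∣ Q` (`ν = 0`). [cite: KoblitzRohrlich1978, §3 Proposition, Cases 2–3 (pp. 1195–1196, (5))] -/
theorem orbit_sum_compare (hp : p.Prime) {r s t r' s' t' : ZMod (p * Q)} (hr : r ≠ 0) (hrst : r + s + t = 0) (hr' : r' ≠ 0)
    (hrst' : r' + s' + t' = 0) (hprim : ∀ q : ℕ, q.Prime → q ∣ p * Q → ¬(q ∣ r.val ∧ q ∣ s.val ∧ q ∣ t.val))
    (hprim' : ∀ q : ℕ, q.Prime → q ∣ p * Q → ¬(q ∣ r'.val ∧ q ∣ s'.val ∧ q ∣ t'.val))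
    (hEq : fermatCMType (p * Q) r s t = fermatCMType (p * Q) r' s' t') {h₀ : ZMod (p * Q)} (hh₀ : IsUnit h₀) :
    ∃ E E' : ℕ,
      ∑ i ∈ range p, ((h₀ * (1 + (i : ZMod (p * Q)) * (Q : ZMod (p * Q))) * r).val +
          (h₀ * (1 + (i : ZMod (p * Q)) * (Q : ZMod (p * Q))) * s).val + (h₀ * (1 + (i : ZMod (p * Q)) * (Q : ZMod (p * Q))) * t).val) + E' =
        ∑ i ∈ range p, ((h₀ * (1 + (i : ZMod (p * Q)) * (Q : ZMod (p * Q))) * r').val +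
          (h₀ * (1 + (i : ZMod (p * Q)) * (Q : ZMod (p * Q))) * s').val + (h₀ * (1 + (i : ZMod (p * Q)) * (Q : ZMod (p * Q))) * t').val) + E ∧
      ((E = 0 ∧ E' = 0) ∨ (p * Q ≤ E ∧ E ≤ 2 * (p * Q) ∧ p * Q ≤ E' ∧ E' ≤ 2 * (p * Q))) ∧ (p ∣ Q → E = 0 ∧ E' = 0) := by
  set O : ℕ → ZMod (p * Q) := fun i => h₀ * (1 + (i : ZMod (p * Q)) * (Q : ZMod (p * Q))) with hO
  set S : ℕ → ℕ := fun i => (O i * r).val + (O i * s).val + (O i * t).val with hS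
  set S' : ℕ → ℕ := fun i => (O i * r').val + (O i * s').val + (O i * t').val with hS'
  set C := (range p).filter fun i : ℕ => ¬IsUnit (O i) with hC
  have hCle : C.card ≤ 1 := card_filter_not_isUnit_orbit_le_one hp hh₀
  -- on the units of the orbit the two summands agree
  have hval : ∀ {a b c : ZMod (p * Q)}, a ≠ 0 → a + b + c = 0 → ∀ i, IsUnit (O i) →
      ((O i * a).val + (O i * b).val + (O i * c).val = p * Q ↔ O i ∈ fermatCMType (p * Q) a b c) ∧
      ((O i * a).val + (O i * b).val + (O i * c).val = p * Q ∨ (O i * a).val + (O i * b).val + (O i * c).val = 2 * (p * Q)) := by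
    intro a b c ha habc i hu
    refine ⟨by rw [mem_fermatCMType_iff_bt, and_iff_right ((isUnit_iff_val_coprime_bt _).1 hu)], ?_⟩
    obtain ⟨k, hk, e⟩ := exists_val_sum_eq_mul_bt habc (O i)
    have hpos : 0 < (O i * a).val := Nat.pos_of_ne_zero fun h => ha (hu.mul_right_eq_zero.1 ((ZMod.val_eq_zero _).1 h))
    interval_cases k <;> omega
  have hN : 0 < p * Q := Nat.pos_of_ne_zero (NeZero.ne _)
  have hagree : ∀ i ∈ (range p).filter (fun i => IsUnit (O i)), S i = S' i := fun i hi => by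
    have hu := (mem_filter.1 hi).2
    obtain ⟨h1, h2⟩ := hval hr hrst i hu
    obtain ⟨h1', h2'⟩ := hval hr' hrst' i hu
    change (O i * r).val + (O i * s).val + (O i * t).val = (O i * r').val + (O i * s').val + (O i * t').val
    rw [hEq] at h1
    rcases h2 with h2 | h2 <;> rcases h2' with h2' | h2'
    · omega
    · exact absurd (h1'.2 (h1.1 h2)) (by omega)
    · exact absurd (h1.2 (h1'.1 h2')) (by omega)
    · omega
  refine ⟨∑ i ∈ C, S i, ∑ i ∈ C, S' i, ?_, ?_, ?_⟩
  · change ∑ i ∈ range p, S i + ∑ i ∈ C, S' i = ∑ i ∈ range p, S' i + ∑ i ∈ C, S i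
    rw [← sum_filter_add_sum_filter_not (range p) (fun i => IsUnit (O i)) S,
      ← sum_filter_add_sum_filter_not (range p) (fun i => IsUnit (O i)) S', sum_congr rfl hagree]
    ring
  · rcases Nat.le_one_iff_eq_zero_or_eq_one.1 hCle with hc | hc
    · left; rw [card_eq_zero.1 hc, sum_empty, sum_empty]; exact ⟨rfl, rfl⟩
    · obtain ⟨i₀, hCi⟩ := card_eq_one.1 hc
      rw [hCi, sum_singleton, sum_singleton]
      obtain ⟨k, hk, e⟩ := exists_val_sum_eq_mul_bt hrst (O i₀)
      obtain ⟨k', hk', e'⟩ := exists_val_sum_eq_mul_bt hrst' (O i₀)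
      by_cases hz : O i₀ = 0
      · left
        change (O i₀ * r).val + (O i₀ * s).val + (O i₀ * t).val = 0 ∧ (O i₀ * r').val + (O i₀ * s').val + (O i₀ * t').val = 0
        simp [hz]
      · right
        -- `O i₀ ≠ 0` forces `Q ≥ 2` (for `Q = 1`, `p ∣ 1 + i₀` makes `O i₀ = 0`), and then primitivity forbids a vanishing sum
        have hi₀ : i₀ ∈ C := by rw [hCi]; exact mem_singleton_self _
        have hdiv := dvd_of_not_isUnit_orbit hp hh₀ (mem_filter.1 hi₀).2
        have hQ2 : 2 ≤ Q := by
          by_contra hQ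
          have hQ0 : Q ≠ 0 := fun h => NeZero.ne (p * Q) (by rw [h, mul_zero])
          have hQ1 : Q = 1 := by omega
          apply hz
          change h₀ * (1 + (i₀ : ZMod (p * Q)) * (Q : ZMod (p * Q))) = 0
          have e1 : (1 + (i₀ : ZMod (p * Q)) * (Q : ZMod (p * Q))) = ((1 + i₀ * Q : ℕ) : ZMod (p * Q)) := by push_cast; ring
          have hd' : p * Q ∣ 1 + i₀ * Q := by rw [hQ1, mul_one] at hdiv ⊢; rw [mul_one]; exact hdiv
          rw [e1, (ZMod.natCast_eq_zero_iff _ _).2 hd', mul_zero]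
        have hne : ∀ {a b c : ZMod (p * Q)}, (∀ q : ℕ, q.Prime → q ∣ p * Q → ¬(q ∣ a.val ∧ q ∣ b.val ∧ q ∣ c.val)) →
            (O i₀ * a).val + (O i₀ * b).val + (O i₀ * c).val ≠ 0 := fun {a b c} hpr h0 =>
          not_dvd_three_of_primitive hpr hQ2
            ⟨dvd_val_of_orbit_mul_val_eq_zero hh₀ (i := i₀) (x := a) (by change (O i₀ * a).val = 0; omega),
              dvd_val_of_orbit_mul_val_eq_zero hh₀ (i := i₀) (x := b) (by change (O i₀ * b).val = 0; omega),
              dvd_val_of_orbit_mul_val_eq_zero hh₀ (i := i₀) (x := c) (by change (O i₀ * c).val = 0; omega)⟩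
        have h1 := hne hprim
        have h2 := hne hprim'
        change p * Q ≤ (O i₀ * r).val + (O i₀ * s).val + (O i₀ * t).val ∧
          (O i₀ * r).val + (O i₀ * s).val + (O i₀ * t).val ≤ 2 * (p * Q) ∧
          p * Q ≤ (O i₀ * r').val + (O i₀ * s').val + (O i₀ * t').val ∧
          (O i₀ * r').val + (O i₀ * s').val + (O i₀ * t').val ≤ 2 * (p * Q)
        have hN : 0 < p * Q := Nat.pos_of_ne_zero (NeZero.ne _)
        refine ⟨?_, ?_, ?_, ?_⟩
        · interval_cases k <;> omega
        · interval_cases k <;> omega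
        · interval_cases k' <;> omega
        · interval_cases k' <;> omega
  · intro hpQ
    have hCe : C = ∅ := by
      refine filter_eq_empty_iff.2 fun i _ hni => ?_
      have hd := dvd_of_not_isUnit_orbit hp hh₀ hni
      exact hp.one_lt.ne' (Nat.dvd_one.1 ((Nat.dvd_add_left (dvd_mul_of_dvd_right hpQ i)).1 hd))
    rw [hCe, sum_empty, sum_empty]
    exact ⟨rfl, rfl⟩

end Compare

/-! ## §3 CASE 3: "`p | N, r`, `p ∤ s t r′ s′ t′`" is impossible when `p² ∣ N` or `p ≥ 11` -/

section CaseThree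

variable {p Q : ℕ} [NeZero (p * Q)]

/-- For `N = pQ`, `r ≠ 0` and `p ∣ ⟨r⟩`: `Q ≥ 2`. [folklore] -/
private theorem two_le_of_dvd_val_bt {r : ZMod (p * Q)} (hr : r ≠ 0) (hpr : p ∣ r.val) : 2 ≤ Q := by
  have hpos : 0 < r.val := Nat.pos_of_ne_zero fun h => hr ((ZMod.val_eq_zero r).1 h)
  have hle : p ≤ r.val := Nat.le_of_dvd hpos hpr
  have hlt : r.val < p * Q := ZMod.val_lt r
  by_contra hQ
  have := Nat.mul_le_mul_left p (by omega : Q ≤ 1)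
  omega

/-- **The residues mod `N/p` of a primitive triple do not all vanish**: for a unit `h₀`, a triple with `a + b + c = 0` no prime of
`N = pQ` dividing all of `⟨a⟩, ⟨b⟩, ⟨c⟩`, and `Q ≥ 2`, the sum `⟨h₀a⟩_Q + ⟨h₀b⟩_Q + ⟨h₀c⟩_Q` of least residues mod `Q = N/p` is a
POSITIVE multiple of `Q`, so `≥ Q` ("because `r₀′ + s₀′ + t₀′ = N/p` or `2N/p`"). [cite: KoblitzRohrlich1978, §3 Case 1 (p. 1194)] -/
private theorem le_residue_sum_bt {h₀ : ZMod (p * Q)} (hh₀ : IsUnit h₀) {a b c : ZMod (p * Q)} (habc : a + b + c = 0)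
    (hprim : ∀ q : ℕ, q.Prime → q ∣ p * Q → ¬(q ∣ a.val ∧ q ∣ b.val ∧ q ∣ c.val)) (hQ2 : 2 ≤ Q) :
    Q ≤ (h₀ * a).val % Q + (h₀ * b).val % Q + (h₀ * c).val % Q := by
  obtain ⟨k, -, e⟩ := exists_val_sum_eq_mul_bt habc h₀
  have hdvd : Q ∣ (h₀ * a).val % Q + (h₀ * b).val % Q + (h₀ * c).val % Q :=
    (Nat.modEq_zero_iff_dvd).1
      ((((Nat.mod_modEq _ Q).add (Nat.mod_modEq _ Q)).add (Nat.mod_modEq _ Q)).trans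
        (Nat.modEq_zero_iff_dvd.2 ⟨k * p, by rw [e]; ring⟩))
  have hX0 : (h₀ * a).val % Q + (h₀ * b).val % Q + (h₀ * c).val % Q ≠ 0 := by
    intro h0
    have ha : Q ∣ (h₀ * a).val := Nat.dvd_of_mod_eq_zero (by omega)
    have hb : Q ∣ (h₀ * b).val := Nat.dvd_of_mod_eq_zero (by omega)
    have hc : Q ∣ (h₀ * c).val := Nat.dvd_of_mod_eq_zero (by omega)
    exact not_dvd_three_of_primitive hprim hQ2 ⟨dvd_val_of_dvd_val_mul (dvd_mul_left Q p) hh₀ ha,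
      dvd_val_of_dvd_val_mul (dvd_mul_left Q p) hh₀ hb, dvd_val_of_dvd_val_mul (dvd_mul_left Q p) hh₀ hc⟩
  exact Nat.le_of_dvd (Nat.pos_of_ne_zero hX0) hdvd

omit [NeZero (p * Q)] in
/-- `p·⟨x⟩_Q + p ≤ N`: the least residue mod `Q = N/p` is `< N/p` ("`0 < s₀′ + t₀′ < 2N/p`"). [cite: KoblitzRohrlich1978, §3 Case 1 (p. 1194)] -/
private theorem mul_mod_add_le_bt (hQ : 0 < Q) (x : ℕ) : p * (x % Q) + p ≤ p * Q := by
  have h := Nat.mul_le_mul_left p (Nat.mod_lt x hQ)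
  rw [Nat.mul_succ] at h
  exact h

/-- **KOBLITZ–ROHRLICH §3 PROPOSITION, CASE 3** ("Case 3. There exists a prime `p | N, r`, `p ∤ str′s′t′`", pp. 1196–1197) in the regimes
`p² ∣ N` (`ν = 0`: "Note that when `ν = 0`, (9) gives `0 < p/a − p/2 + 3/2 ≤ 0` for all `a ≥ 5, p ≥ 5`"), `p ≥ 11` ("If `p ≥ 11`, (9)
implies `0 < p/a − p/2 + 5/2 ≤ 5/2 − 3p/10 < 0`, a contradiction") and `p ≥ 7, a ≥ 7` ("If `p = 7` and `a ≥ 7`, then we obtain `0 < p/7 −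
p/2 + 5/2 = 0`, again a contradiction"; `a = N/g.c.d.(N, r)`): at level `N = pQ` prime to `6`, `p ≥ 5` prime, for admissible triples
`τ = (r,s,t)`, `τ′ = (r′,s′,t′)` (here: `r, r′ ≠ 0`, sums `0`) that are primitive (no prime of `N` divides all of `⟨r⟩, ⟨s⟩, ⟨t⟩`, resp.
`⟨r′⟩, ⟨s′⟩, ⟨t′⟩` — K–R's normalisation after Case 1), `p ∣ ⟨r⟩` and `p ∤ ⟨r′⟩, ⟨s′⟩, ⟨t′⟩` force **`H_τ ≠ H_{τ′}`**.  Road: K–R's orbit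
sums over `h₀P` with `h₀` the unit making `⟨h₀r⟩ = g.c.d.(N, r)` ("we may assume that `r = g.c.d.(N, r)`"; `a = N/r ≥ 5`):
`Σ_τ = p·r + p(s₀ + t₀) + (p−1)N`, `Σ_{τ′} = p(r₀′ + s₀′ + t₀′) + 3(p−1)N/2`, `|Σ_τ − Σ_{τ′}| ≤ νN` (8).  The cases `p = 7, a = 5` (K–R:
re-dispatch on another prime, else `N = 35` "easily checked by hand") and `p = 5, 5² ∤ N` (the omitted "tedious examination") are NOT
covered. [cite: KoblitzRohrlich1978, §3 Proposition, Case 3 (pp. 1196–1197, (8)–(9))] -/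
theorem fermatCMType_ne_of_dvd_of_not_dvd_of_sq_dvd_or_le_or_gcd (hp : p.Prime) (hp5 : 5 ≤ p)
    (hN2 : Nat.Coprime 2 (p * Q)) (hN3 : Nat.Coprime 3 (p * Q)) {r s t r' s' t' : ZMod (p * Q)}
    (hν : p ∣ Q ∨ 11 ≤ p ∨ (7 ≤ p ∧ 7 * Nat.gcd r.val (p * Q) ≤ p * Q))
    (hr : r ≠ 0) (hrst : r + s + t = 0) (hr' : r' ≠ 0) (hrst' : r' + s' + t' = 0)
    (hprim : ∀ q : ℕ, q.Prime → q ∣ p * Q → ¬(q ∣ r.val ∧ q ∣ s.val ∧ q ∣ t.val))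
    (hprim' : ∀ q : ℕ, q.Prime → q ∣ p * Q → ¬(q ∣ r'.val ∧ q ∣ s'.val ∧ q ∣ t'.val))
    (hpr : p ∣ r.val) (hpr' : ¬p ∣ r'.val) (hps' : ¬p ∣ s'.val) (hpt' : ¬p ∣ t'.val) :
    fermatCMType (p * Q) r s t ≠ fermatCMType (p * Q) r' s' t' := by
  intro hEq
  have hQ2 : 2 ≤ Q := two_le_of_dvd_val_bt hr hpr
  have hQ0 : 0 < Q := by omega
  have hN0 : 0 < p * Q := Nat.pos_of_ne_zero (NeZero.ne _)
  -- `p ∤ s, t` (primitivity of `τ` at `p`)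
  have hps : ¬p ∣ s.val := fun h => hprim p hp (dvd_mul_right p Q) ⟨hpr, h, (dvd_val_iff_of_add_eq_zero hrst hpr).1 h⟩
  have hpt : ¬p ∣ t.val := fun h => hps ((dvd_val_iff_of_add_eq_zero hrst hpr).2 h)
  -- K–R's normalisation `⟨h₀r⟩ = g.c.d.(N, r)`, and `5·g.c.d. ≤ N`
  obtain ⟨h₀, hh₀, hg⟩ := exists_isUnit_val_mul_eq_gcd hr
  have h5g : 5 * (p * (h₀ * r).val) ≤ p * (p * Q) := by
    have h := Nat.mul_le_mul_left p (five_mul_gcd_val_le hN2 hN3 hr)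
    rw [← hg] at h
    linarith
  have h7g : 7 * Nat.gcd r.val (p * Q) ≤ p * Q → 7 * (p * (h₀ * r).val) ≤ p * (p * Q) := fun h7 => by
    have h := Nat.mul_le_mul_left p h7
    rw [← hg] at h
    linarith
  -- the orbit sums over `h₀P`
  obtain ⟨E, E', hcmp, hE, hE0⟩ := orbit_sum_compare hp hr hrst hr' hrst' hprim hprim' hEq hh₀
  simp only [sum_add_distrib] at hcmp
  have hTr := sum_val_orbit_mul_of_dvd h₀ r hpr
  have hTs := two_mul_sum_val_orbit_mul hp h₀ s (not_dvd_val_mul_bt hp hh₀ s hps)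
  have hTt := two_mul_sum_val_orbit_mul hp h₀ t (not_dvd_val_mul_bt hp hh₀ t hpt)
  have hTr' := two_mul_sum_val_orbit_mul hp h₀ r' (not_dvd_val_mul_bt hp hh₀ r' hpr')
  have hTs' := two_mul_sum_val_orbit_mul hp h₀ s' (not_dvd_val_mul_bt hp hh₀ s' hps')
  have hTt' := two_mul_sum_val_orbit_mul hp h₀ t' (not_dvd_val_mul_bt hp hh₀ t' hpt')
  -- "`s₀ + t₀ < 2N/p`", "`r₀′ + s₀′ + t₀′ ≥ N/p`", `(p − 1)N + N = pN`, `5N ≤ pN`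
  have hs₀ := mul_mod_add_le_bt (p := p) hQ0 (h₀ * s).val
  have ht₀ := mul_mod_add_le_bt (p := p) hQ0 (h₀ * t).val
  have hX' := Nat.mul_le_mul_left p (le_residue_sum_bt hh₀ hrst' hprim' hQ2)
  have hA : Q * (p * (p - 1)) + p * Q = p * (p * Q) := by zify [hp.one_le]; ring
  have h5 : 5 * (p * Q) ≤ p * (p * Q) := Nat.mul_le_mul_right _ hp5
  rcases hE with ⟨rfl, rfl⟩ | ⟨hE1, hE2, hE1', hE2'⟩
  · -- `ν = 0` road: "(9) gives `0 < p/a − p/2 + 3/2 ≤ 0`"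
    linarith
  · rcases hν with hpQ | h11 | ⟨h7, h7g'⟩
    · have := (hE0 hpQ).1; omega
    · -- "If `p ≥ 11`, (9) implies … `< 0`"
      have h11' : 11 * (p * Q) ≤ p * (p * Q) := Nat.mul_le_mul_right _ h11
      linarith
    · -- "If `p = 7` and `a ≥ 7`, then we obtain `0 < p/7 − p/2 + 5/2 = 0`, again a contradiction"
      have h7' : 7 * (p * Q) ≤ p * (p * Q) := Nat.mul_le_mul_right _ h7
      have := h7g h7g'
      linarith


/-- **CASE 3 in the regimes `p² ∣ N` or `p ≥ 11`** (the form used by the assembly below). [cite: KoblitzRohrlich1978, §3 Proposition, Case 3 (pp. 1196–1197)] -/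
theorem fermatCMType_ne_of_dvd_of_not_dvd_of_sq_dvd_or_le (hp : p.Prime) (hp5 : 5 ≤ p) (hν : p ∣ Q ∨ 11 ≤ p)
    (hN2 : Nat.Coprime 2 (p * Q)) (hN3 : Nat.Coprime 3 (p * Q)) {r s t r' s' t' : ZMod (p * Q)}
    (hr : r ≠ 0) (hrst : r + s + t = 0) (hr' : r' ≠ 0) (hrst' : r' + s' + t' = 0)
    (hprim : ∀ q : ℕ, q.Prime → q ∣ p * Q → ¬(q ∣ r.val ∧ q ∣ s.val ∧ q ∣ t.val))
    (hprim' : ∀ q : ℕ, q.Prime → q ∣ p * Q → ¬(q ∣ r'.val ∧ q ∣ s'.val ∧ q ∣ t'.val))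
    (hpr : p ∣ r.val) (hpr' : ¬p ∣ r'.val) (hps' : ¬p ∣ s'.val) (hpt' : ¬p ∣ t'.val) :
    fermatCMType (p * Q) r s t ≠ fermatCMType (p * Q) r' s' t' :=
  fermatCMType_ne_of_dvd_of_not_dvd_of_sq_dvd_or_le_or_gcd hp hp5 hN2 hN3 (hν.imp_right Or.inl) hr hrst hr' hrst' hprim hprim'
    hpr hpr' hps' hpt'

end CaseThree

/-! ## §4 CASE 2: "`p | N, r, r′`, `p ∤ sts′t′`" forces `r = r′` when `p² ∣ N` or `p ≥ 11` -/

section CaseTwo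

variable {p Q : ℕ} [NeZero (p * Q)]

/-- **KOBLITZ–ROHRLICH §3 PROPOSITION, CASE 2** ("Case 2. There exists a prime `p` dividing `N, r, r′` but not dividing `sts′t′`; and
`r ≠ r′`", pp. 1195–1196) in the regimes `p² ∣ N` or `p ≥ 11` ("First suppose `p > 5`, or `p = 5` and `5² | N` (so that `ν = 0`). By
the lemma applied with `x = r, y = r′`, if we multiply through by a suitable `u ∈ (ℤ/Nℤ)*` … which contradicts (6)"): at level `N = pQ`
prime to `6`, `p ≥ 5` prime with `p ∣ Q` or `p ≥ 11`, for admissible primitive triples with `H_τ = H_{τ′}`, `p ∣ ⟨r⟩` and `p ∣ ⟨r′⟩`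
force **`r = r′`**.  Road: K–R's orbit sums (5)–(6) over `uP`, with K–R's omitted Lemma (a unit `u` with `⌊⟨ur⟩/(N/p)⌋`, `⌊⟨ur′⟩/(N/p)⌋`
far apart) REPLACED by the Case-1 unit `u` with `2N/5 ≤ ⟨u(r − r′)⟩ ≤ 3N/5` (sibling `exists_isUnit_val_mul_mem_middle`), which
separates `p⟨ur⟩` from `p⟨ur′⟩` by more than `|Σ_{uτ} − Σ_{uτ′}| + 2N` exactly when `ν = 0` or `p ≥ 11`.  K–R's remaining sub-case
"`N = 5N₀, 5 ∤ N₀, 5 | r, r′`" (p. 1196) and `p = 7, 7² ∤ N` are NOT covered. [cite: KoblitzRohrlich1978, §3 Proposition, Case 2 (pp. 1195–1196, (5)–(6))] -/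
theorem eq_of_fermatCMType_eq_of_dvd_of_dvd_of_sq_dvd_or_le (hp : p.Prime) (hp5 : 5 ≤ p) (hν : p ∣ Q ∨ 11 ≤ p)
    (hN2 : Nat.Coprime 2 (p * Q)) (hN3 : Nat.Coprime 3 (p * Q)) {r s t r' s' t' : ZMod (p * Q)}
    (hr : r ≠ 0) (hrst : r + s + t = 0) (hr' : r' ≠ 0) (hrst' : r' + s' + t' = 0)
    (hprim : ∀ q : ℕ, q.Prime → q ∣ p * Q → ¬(q ∣ r.val ∧ q ∣ s.val ∧ q ∣ t.val))
    (hprim' : ∀ q : ℕ, q.Prime → q ∣ p * Q → ¬(q ∣ r'.val ∧ q ∣ s'.val ∧ q ∣ t'.val))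
    (hpr : p ∣ r.val) (hpr' : p ∣ r'.val) (hEq : fermatCMType (p * Q) r s t = fermatCMType (p * Q) r' s' t') : r = r' := by
  by_contra hne
  have hQ2 : 2 ≤ Q := two_le_of_dvd_val_bt hr hpr
  have hQ0 : 0 < Q := by omega
  have hN0 : 0 < p * Q := Nat.pos_of_ne_zero (NeZero.ne _)
  have hps : ¬p ∣ s.val := fun h => hprim p hp (dvd_mul_right p Q) ⟨hpr, h, (dvd_val_iff_of_add_eq_zero hrst hpr).1 h⟩
  have hpt : ¬p ∣ t.val := fun h => hps ((dvd_val_iff_of_add_eq_zero hrst hpr).2 h)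
  have hps' : ¬p ∣ s'.val := fun h => hprim' p hp (dvd_mul_right p Q) ⟨hpr', h, (dvd_val_iff_of_add_eq_zero hrst' hpr').1 h⟩
  have hpt' : ¬p ∣ t'.val := fun h => hps' ((dvd_val_iff_of_add_eq_zero hrst' hpr').2 h)
  -- the unit `u` with `2N/5 ≤ ⟨u(r − r′)⟩ ≤ 3N/5`
  obtain ⟨u, hu, hD1, hD2⟩ := exists_isUnit_val_mul_mem_middle hN2 hN3 (sub_ne_zero.2 hne)
  -- `⟨ur⟩ ≡ ⟨ur′⟩ + ⟨u(r − r′)⟩ (mod N)`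
  have hsplit : (u * r).val = (u * r').val + (u * (r - r')).val ∨
      (u * r).val + p * Q = (u * r').val + (u * (r - r')).val := by
    have e : u * r = u * r' + u * (r - r') := by ring
    rcases Nat.lt_or_ge ((u * r').val + (u * (r - r')).val) (p * Q) with h | h
    · left; rw [e, ZMod.val_add_of_lt h]
    · right; rw [e]; exact (ZMod.val_add_val_of_le h).symm
  -- the orbit sums over `uP` ((5): they agree up to `νN`)
  obtain ⟨E, E', hcmp, hE, hE0⟩ := orbit_sum_compare hp hr hrst hr' hrst' hprim hprim' hEq hu
  simp only [sum_add_distrib] at hcmp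
  have hTr := sum_val_orbit_mul_of_dvd u r hpr
  have hTr' := sum_val_orbit_mul_of_dvd u r' hpr'
  have hTs := two_mul_sum_val_orbit_mul hp u s (not_dvd_val_mul_bt hp hu s hps)
  have hTt := two_mul_sum_val_orbit_mul hp u t (not_dvd_val_mul_bt hp hu t hpt)
  have hTs' := two_mul_sum_val_orbit_mul hp u s' (not_dvd_val_mul_bt hp hu s' hps')
  have hTt' := two_mul_sum_val_orbit_mul hp u t' (not_dvd_val_mul_bt hp hu t' hpt')
  have hs₀ := mul_mod_add_le_bt (p := p) hQ0 (u * s).val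
  have ht₀ := mul_mod_add_le_bt (p := p) hQ0 (u * t).val
  have hs₀' := mul_mod_add_le_bt (p := p) hQ0 (u * s').val
  have ht₀' := mul_mod_add_le_bt (p := p) hQ0 (u * t').val
  have h5 : 5 * (p * Q) ≤ p * (p * Q) := Nat.mul_le_mul_right _ hp5
  have hD1p := Nat.mul_le_mul_left p hD1
  have hD2p := Nat.mul_le_mul_left p hD2
  have hnn₁ := Nat.zero_le (p * ((u * s).val % Q))
  have hnn₂ := Nat.zero_le (p * ((u * t).val % Q))
  have hnn₃ := Nat.zero_le (p * ((u * s').val % Q))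
  have hnn₄ := Nat.zero_le (p * ((u * t').val % Q))
  rcases hsplit with e | e <;> have ep := congrArg (p * ·) e <;> simp only [Nat.mul_add] at ep <;>
    rcases hE with ⟨rfl, rfl⟩ | ⟨hE1, hE2, hE1', hE2'⟩
  · linarith
  · rcases hν with hpQ | h11
    · have := (hE0 hpQ).1; omega
    · have h11' : 11 * (p * Q) ≤ p * (p * Q) := Nat.mul_le_mul_right _ h11
      linarith
  · linarith
  · rcases hν with hpQ | h11
    · have := (hE0 hpQ).1; omega
    · have h11' : 11 * (p * Q) ≤ p * (p * Q) := Nat.mul_le_mul_right _ h11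
      linarith

end CaseTwo

/-! ## §5 The Proposition in the regimes `p² ∣ N` or `p ≥ 11`: a boundary entry matches, and "`τ′` is a permutation of `τ`" -/

section Proposition

variable {p Q : ℕ} [NeZero (p * Q)]

/-- `H_{(a,b,c)} = H_{(b,a,c)}`. [cite: KoblitzRohrlich1978, §1 (p. 1184: "`H_{r,s,t}` depends on `{r, s, t}` only up to permutation")] -/
private theorem fermatCMType_swap₁₂_bt {m : ℕ} [NeZero m] (a b c : ZMod m) : fermatCMType m a b c = fermatCMType m b a c := by
  ext x; simp only [fermatCMType, mem_filter, mem_univ, true_and]; constructor <;> rintro ⟨h1, h2⟩ <;> exact ⟨h1, by omega⟩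

/-- `H_{(a,b,c)} = H_{(c,b,a)}`. [cite: KoblitzRohrlich1978, §1 (p. 1184)] -/
private theorem fermatCMType_swap₁₃_bt {m : ℕ} [NeZero m] (a b c : ZMod m) : fermatCMType m a b c = fermatCMType m c b a := by
  ext x; simp only [fermatCMType, mem_filter, mem_univ, true_and]; constructor <;> rintro ⟨h1, h2⟩ <;> exact ⟨h1, by omega⟩

/-- `H_{(a,b,c)} = H_{(a,c,b)}`. [cite: KoblitzRohrlich1978, §1 (p. 1184)] -/
private theorem fermatCMType_swap₂₃_bt {m : ℕ} [NeZero m] (a b c : ZMod m) : fermatCMType m a b c = fermatCMType m a c b := by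
  ext x; simp only [fermatCMType, mem_filter, mem_univ, true_and]; constructor <;> rintro ⟨h1, h2⟩ <;> exact ⟨h1, by omega⟩

/-- **A boundary entry of `τ` is an entry of `τ′`** (Cases 2 and 3 together; "Suppose `N` is not prime to `rstr′s′t′`" — w.l.o.g. `p | r`):
at `N = pQ` prime to `6`, `p ≥ 5` prime with `p ∣ Q` or `p ≥ 11`, for admissible primitive triples (all six entries non-zero) with
`H_τ = H_{τ′}` and `p ∣ ⟨r⟩`: **`r = r′` or `r = s′` or `r = t′`** (by Case 3 `p` divides one of `r′, s′, t′`; by Case 2 applied to the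
correspondingly permuted `τ′`, that entry is `r`). [cite: KoblitzRohrlich1978, §3 Proposition, Cases 2–3 (pp. 1195–1197)] -/
theorem eq_or_eq_or_eq_of_fermatCMType_eq_of_dvd (hp : p.Prime) (hp5 : 5 ≤ p) (hν : p ∣ Q ∨ 11 ≤ p)
    (hN2 : Nat.Coprime 2 (p * Q)) (hN3 : Nat.Coprime 3 (p * Q)) {r s t r' s' t' : ZMod (p * Q)}
    (hr : r ≠ 0) (hrst : r + s + t = 0) (hr' : r' ≠ 0) (hs' : s' ≠ 0) (ht' : t' ≠ 0) (hrst' : r' + s' + t' = 0)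
    (hprim : ∀ q : ℕ, q.Prime → q ∣ p * Q → ¬(q ∣ r.val ∧ q ∣ s.val ∧ q ∣ t.val))
    (hprim' : ∀ q : ℕ, q.Prime → q ∣ p * Q → ¬(q ∣ r'.val ∧ q ∣ s'.val ∧ q ∣ t'.val))
    (hpr : p ∣ r.val) (hEq : fermatCMType (p * Q) r s t = fermatCMType (p * Q) r' s' t') : r = r' ∨ r = s' ∨ r = t' := by
  by_cases h1 : p ∣ r'.val
  · exact Or.inl (eq_of_fermatCMType_eq_of_dvd_of_dvd_of_sq_dvd_or_le hp hp5 hν hN2 hN3 hr hrst hr' hrst' hprim hprim' hpr h1 hEq)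
  by_cases h2 : p ∣ s'.val
  · refine Or.inr (Or.inl (eq_of_fermatCMType_eq_of_dvd_of_dvd_of_sq_dvd_or_le hp hp5 hν hN2 hN3 hr hrst hs'
      (by rw [add_comm s' r']; exact hrst') hprim (fun q hq hqN h => hprim' q hq hqN ⟨h.2.1, h.1, h.2.2⟩) hpr h2
      (hEq.trans (fermatCMType_swap₁₂_bt r' s' t'))))
  by_cases h3 : p ∣ t'.val
  · refine Or.inr (Or.inr (eq_of_fermatCMType_eq_of_dvd_of_dvd_of_sq_dvd_or_le hp hp5 hν hN2 hN3 hr hrst ht'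
      (by rw [show t' + s' + r' = r' + s' + t' by ring]; exact hrst') hprim (fun q hq hqN h => hprim' q hq hqN ⟨h.2.2, h.2.1, h.1⟩)
      hpr h3 (hEq.trans (fermatCMType_swap₁₃_bt r' s' t'))))
  exact absurd hEq (fermatCMType_ne_of_dvd_of_not_dvd_of_sq_dvd_or_le hp hp5 hν hN2 hN3 hr hrst hr' hrst' hprim hprim' hpr h1 h2 h3)

/-- **"In the case that `r = r′` …, suppose further that `N` is not prime to `sts′t′` … Then `τ′` is a permutation of `τ`"** — the
matched form, with the second boundary prime `p` (in the regime `p² ∣ N` or `p ≥ 11`) dividing `⟨s⟩`: at `N = pQ` prime to `6`, for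
admissible primitive triples with `H_τ = H_{τ′}`, `r = r′` and `p ∣ ⟨s⟩` give **`{r, s, t} = {r′, s′, t′}`** (as multisets).
[cite: KoblitzRohrlich1978, §3 Proposition (p. 1193), Cases 2–3 (pp. 1195–1197)] -/
theorem multiset_eq_of_fermatCMType_eq_of_eq_of_dvd (hp : p.Prime) (hp5 : 5 ≤ p) (hν : p ∣ Q ∨ 11 ≤ p)
    (hN2 : Nat.Coprime 2 (p * Q)) (hN3 : Nat.Coprime 3 (p * Q)) {r s t r' s' t' : ZMod (p * Q)}
    (hs : s ≠ 0) (hrst : r + s + t = 0) (hr' : r' ≠ 0) (hs' : s' ≠ 0) (ht' : t' ≠ 0) (hrst' : r' + s' + t' = 0)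
    (hprim : ∀ q : ℕ, q.Prime → q ∣ p * Q → ¬(q ∣ r.val ∧ q ∣ s.val ∧ q ∣ t.val))
    (hprim' : ∀ q : ℕ, q.Prime → q ∣ p * Q → ¬(q ∣ r'.val ∧ q ∣ s'.val ∧ q ∣ t'.val))
    (hEq : fermatCMType (p * Q) r s t = fermatCMType (p * Q) r' s' t') (hrr' : r = r') (hps : p ∣ s.val) :
    ({r, s, t} : Multiset (ZMod (p * Q))) = {r', s', t'} := by
  have hstr : s + t + r = 0 := by rw [show s + t + r = r + s + t by ring]; exact hrst
  have hEq₁ : fermatCMType (p * Q) s t r = fermatCMType (p * Q) r' s' t' :=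
    ((fermatCMType_swap₁₃_bt s t r).trans (fermatCMType_swap₂₃_bt r t s)).trans hEq
  rcases eq_or_eq_or_eq_of_fermatCMType_eq_of_dvd hp hp5 hν hN2 hN3 hs hstr hr' hs' ht' hrst'
      (fun q hq hqN h => hprim q hq hqN ⟨h.2.2, h.1, h.2.1⟩) hprim' hps hEq₁ with h | h | h
  · -- `s = r′ = r`: then `p ∣ r, s, t`, contradicting primitivity
    have hpr : p ∣ r.val := by rw [hrr', ← h]; exact hps
    exact absurd ⟨hpr, hps, (dvd_val_iff_of_add_eq_zero hrst hpr).1 hps⟩ (hprim p hp (dvd_mul_right p Q))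
  · subst hrr' h
    have htt' : t = t' := by linear_combination hrst - hrst'
    rw [htt']
  · subst hrr' h
    have hts' : t = s' := by linear_combination hrst - hrst'
    rw [hts', Multiset.pair_comm]

/-- Case-2/3 matching at a general level `N` (the prime `p ∣ N` in the regime `p² ∣ N` or `p ≥ 11`): `p ∣ ⟨r⟩` ⟹ `r ∈ {r′, s′, t′}`.
[cite: KoblitzRohrlich1978, §3 Proposition, Cases 2–3 (pp. 1195–1197)] -/
theorem eq_or_eq_or_eq_of_fermatCMType_eq_of_dvd_level {N : ℕ} [NeZero N] {p : ℕ} (hp : p.Prime) (hp5 : 5 ≤ p) (hpN : p ∣ N)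
    (hν : p * p ∣ N ∨ 11 ≤ p) (hN2 : Nat.Coprime 2 N) (hN3 : Nat.Coprime 3 N) {r s t r' s' t' : ZMod N}
    (hr : r ≠ 0) (hrst : r + s + t = 0) (hr' : r' ≠ 0) (hs' : s' ≠ 0) (ht' : t' ≠ 0) (hrst' : r' + s' + t' = 0)
    (hprim : ∀ q : ℕ, q.Prime → q ∣ N → ¬(q ∣ r.val ∧ q ∣ s.val ∧ q ∣ t.val))
    (hprim' : ∀ q : ℕ, q.Prime → q ∣ N → ¬(q ∣ r'.val ∧ q ∣ s'.val ∧ q ∣ t'.val))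
    (hpr : p ∣ r.val) (hEq : fermatCMType N r s t = fermatCMType N r' s' t') : r = r' ∨ r = s' ∨ r = t' := by
  obtain ⟨Q, rfl⟩ := hpN
  exact eq_or_eq_or_eq_of_fermatCMType_eq_of_dvd hp hp5 (hν.imp_left fun h => (Nat.mul_dvd_mul_iff_left hp.pos).1 h) hN2 hN3
    hr hrst hr' hs' ht' hrst' hprim hprim' hpr hEq

/-- The matched form at a general level `N` (`r = r′`, the prime `p ∣ N` in the regime dividing `⟨s⟩`): `{r, s, t} = {r′, s′, t′}`.
[cite: KoblitzRohrlich1978, §3 Proposition (p. 1193), Cases 2–3 (pp. 1195–1197)] -/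
theorem multiset_eq_of_fermatCMType_eq_of_eq_of_dvd_level {N : ℕ} [NeZero N] {p : ℕ} (hp : p.Prime) (hp5 : 5 ≤ p) (hpN : p ∣ N)
    (hν : p * p ∣ N ∨ 11 ≤ p) (hN2 : Nat.Coprime 2 N) (hN3 : Nat.Coprime 3 N) {r s t r' s' t' : ZMod N}
    (hs : s ≠ 0) (hrst : r + s + t = 0) (hr' : r' ≠ 0) (hs' : s' ≠ 0) (ht' : t' ≠ 0) (hrst' : r' + s' + t' = 0)
    (hprim : ∀ q : ℕ, q.Prime → q ∣ N → ¬(q ∣ r.val ∧ q ∣ s.val ∧ q ∣ t.val))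
    (hprim' : ∀ q : ℕ, q.Prime → q ∣ N → ¬(q ∣ r'.val ∧ q ∣ s'.val ∧ q ∣ t'.val))
    (hEq : fermatCMType N r s t = fermatCMType N r' s' t') (hrr' : r = r') (hps : p ∣ s.val) :
    ({r, s, t} : Multiset (ZMod N)) = {r', s', t'} := by
  obtain ⟨Q, rfl⟩ := hpN
  exact multiset_eq_of_fermatCMType_eq_of_eq_of_dvd hp hp5 (hν.imp_left fun h => (Nat.mul_dvd_mul_iff_left hp.pos).1 h) hN2 hN3
    hs hrst hr' hs' ht' hrst' hprim hprim' hEq hrr' hps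

/-- **KOBLITZ–ROHRLICH §3 PROPOSITION in the regimes `p² ∣ N` or `p ≥ 11`** (both boundary primes): at a level `N` prime to `6`, for
admissible primitive triples `τ = (r,s,t)`, `τ′ = (r′,s′,t′)` (non-zero entries, `r + s + t = 0 = r′ + s′ + t′`, no prime of `N` dividing all
of `⟨r⟩, ⟨s⟩, ⟨t⟩`, resp. `⟨r′⟩, ⟨s′⟩, ⟨t′⟩`) with `H_τ = H_{τ′}`: if a prime `p ≥ 5` of `N` with `p² ∣ N` or `p ≥ 11` divides `⟨r⟩` ("`N` is
not prime to `rstr′s′t′`") and a prime `q ≥ 5` of `N` with `q² ∣ N` or `q ≥ 11` divides `⟨s⟩` or `⟨t⟩` ("In the case that `r = r′` for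
some ordering of the triples `τ` and `τ′`, suppose further that `N` is not prime to `sts′t′`" — `s, t` are among the entries left after
matching `r`), then **"`τ′` is a permutation of `τ`"**: `{r, s, t} = {r′, s′, t′}` as multisets.  (The variant in which the second prime
divides the two unmatched entries of `τ′` is this theorem with `τ, τ′` exchanged.)  NOT covered: boundary primes `p ∈ {5, 7}` with
`p² ∤ N` (K–R's omitted Lemma, the hand check `N = 35`, the omitted "tedious examination").
[cite: KoblitzRohrlich1978, §3 Proposition (p. 1193), Cases 2–3 (pp. 1195–1197)] -/
theorem multiset_eq_of_fermatCMType_eq_of_dvd_of_dvd {N : ℕ} [NeZero N] (hN2 : Nat.Coprime 2 N) (hN3 : Nat.Coprime 3 N)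
    {p : ℕ} (hp : p.Prime) (hp5 : 5 ≤ p) (hpN : p ∣ N) (hνp : p * p ∣ N ∨ 11 ≤ p)
    {q : ℕ} (hq : q.Prime) (hq5 : 5 ≤ q) (hqN : q ∣ N) (hνq : q * q ∣ N ∨ 11 ≤ q) {r s t r' s' t' : ZMod N}
    (hr : r ≠ 0) (hs : s ≠ 0) (ht : t ≠ 0) (hrst : r + s + t = 0) (hr' : r' ≠ 0) (hs' : s' ≠ 0) (ht' : t' ≠ 0) (hrst' : r' + s' + t' = 0)
    (hprim : ∀ q : ℕ, q.Prime → q ∣ N → ¬(q ∣ r.val ∧ q ∣ s.val ∧ q ∣ t.val))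
    (hprim' : ∀ q : ℕ, q.Prime → q ∣ N → ¬(q ∣ r'.val ∧ q ∣ s'.val ∧ q ∣ t'.val))
    (hEq : fermatCMType N r s t = fermatCMType N r' s' t') (hpr : p ∣ r.val) (hqst : q ∣ s.val ∨ q ∣ t.val) :
    ({r, s, t} : Multiset (ZMod N)) = {r', s', t'} := by
  -- Step 1 (Cases 2–3 at `p`): `r` is an entry of `τ′`; permute `τ′` so that it comes first
  obtain ⟨r₁, s₁, t₁, hr₁, hs₁, ht₁, hrst₁, hprim₁, hEq', hperm, hrr₁⟩ : ∃ r₁ s₁ t₁ : ZMod N, r₁ ≠ 0 ∧ s₁ ≠ 0 ∧ t₁ ≠ 0 ∧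
      r₁ + s₁ + t₁ = 0 ∧ (∀ q : ℕ, q.Prime → q ∣ N → ¬(q ∣ r₁.val ∧ q ∣ s₁.val ∧ q ∣ t₁.val)) ∧
      fermatCMType N r s t = fermatCMType N r₁ s₁ t₁ ∧ ({r₁, s₁, t₁} : Multiset (ZMod N)) = {r', s', t'} ∧ r = r₁ := by
    rcases eq_or_eq_or_eq_of_fermatCMType_eq_of_dvd_level hp hp5 hpN hνp hN2 hN3 hr hrst hr' hs' ht' hrst' hprim hprim' hpr hEq
      with h | h | h
    · exact ⟨r', s', t', hr', hs', ht', hrst', hprim', hEq, rfl, h⟩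
    · exact ⟨s', r', t', hs', hr', ht', by rw [add_comm s' r']; exact hrst', fun q hq hqN h' => hprim' q hq hqN ⟨h'.2.1, h'.1, h'.2.2⟩,
        hEq.trans (fermatCMType_swap₁₂_bt r' s' t'), Multiset.cons_swap s' r' {t'}, h⟩
    · exact ⟨t', s', r', ht', hs', hr', by rw [show t' + s' + r' = r' + s' + t' by ring]; exact hrst',
        fun q hq hqN h' => hprim' q hq hqN ⟨h'.2.2, h'.2.1, h'.1⟩, hEq.trans (fermatCMType_swap₁₃_bt r' s' t'),
        calc ({t', s', r'} : Multiset (ZMod N)) = {t', r', s'} := by rw [Multiset.pair_comm s' r']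
          _ = {r', t', s'} := Multiset.cons_swap t' r' {s'}
          _ = {r', s', t'} := by rw [Multiset.pair_comm t' s'], h⟩
  rw [← hperm]
  -- Step 2 (Cases 2–3 at `q`): the second boundary prime matches the rest
  rcases hqst with hqs | hqt
  · exact multiset_eq_of_fermatCMType_eq_of_eq_of_dvd_level hq hq5 hqN hνq hN2 hN3 hs hrst hr₁ hs₁ ht₁ hrst₁ hprim hprim₁ hEq' hrr₁ hqs
  · have h := multiset_eq_of_fermatCMType_eq_of_eq_of_dvd_level hq hq5 hqN hνq hN2 hN3 ht
      (by rw [show r + t + s = r + s + t by ring]; exact hrst) hr₁ hs₁ ht₁ hrst₁ (fun q hq hqN h' => hprim q hq hqN ⟨h'.1, h'.2.2, h'.2.1⟩)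
      hprim₁ ((fermatCMType_swap₂₃_bt r t s).trans hEq') hrr₁ hqt
    rw [← h, Multiset.pair_comm]

end Proposition

/-! ## §6 ON ABELIAN VARIETIES: in the regimes, isogenies between the varieties of boundary triples are the obvious equalities (Theorem 1 (ii)) -/

section Varieties

variable {N : ℕ} [NeZero N]

/-- `p`-divisibility of representatives is invariant under unit multiples (`p ∣ N`). [folklore] -/
private theorem dvd_val_mul_iff_of_isUnit_bt {p : ℕ} (hpN : p ∣ N) {u : ZMod N} (hu : IsUnit u) (x : ZMod N) :
    p ∣ (u * x).val ↔ p ∣ x.val := by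
  refine ⟨dvd_val_of_dvd_val_mul hpN hu, fun h => ?_⟩
  rw [ZMod.val_mul]
  exact (Nat.dvd_mod_iff hpN).2 (dvd_mul_of_dvd_right h _)

open Literature.AlgebraicGeometry.Motives (AbelianVariety)
open Literature.AlgebraicGeometry.HodgeTheory (complexBetti)
open Literature.AlgebraicGeometry.Pohlmann1968.Cyclotomic (cmTypeOfResidues)
open CyclotomicCMTypeResidueSets (IsCMResidueSet)
open NumberField

variable {L : Type} [Field L] [NumberField L] [IsCyclotomicExtension {N} ℚ L]
  {A A' : AbelianVariety ℂ} {ι : 𝓞 L →+* CategoryTheory.End A} {θ : L →+* Module.End ℂ (complexBetti A.X 1)}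
  {ι' : 𝓞 L →+* CategoryTheory.End A'} {θ' : L →+* Module.End ℂ (complexBetti A'.X 1)}

/-- **THEOREM 1 (ii) FOR BOUNDARY TRIPLES IN THE REGIMES** ("The only isogenies between the lattices `L_{r,s,t}` are the obvious equalities",
with §3's Proposition supplying (i)): at a level `N` prime to `6`, let `A`, `A′` be abelian varieties realising the (full-level) Fermat types
`Φ_{H_τ}`, `Φ_{H_{τ′}}` of `ℚ(ζ_N)` for admissible primitive triples `τ = (r,s,t)`, `τ′ = (r′,s′,t′)`, where a prime `p ∣ N` with `p² ∣ N`
or `p ≥ 11` divides `⟨r⟩` and a prime `q ∣ N` with `q² ∣ N` or `q ≥ 11` divides `⟨s⟩` or `⟨t⟩`.  Then **`A ∼ A′` iff `{r′, s′, t′} =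
{ur, us, ut}` for a unit `u`** — an obvious equality `τ′ ∼ τ` (Shimura–Taniyama: `A ∼ A′ ⟺ H_{τ′} = H_{uτ}`, tree
`isIsogenous_fermatCMType_iff_exists_eq_mul`; then §5 for `uτ`, whose entries have the same divisibilities).
[cite: KoblitzRohrlich1978, Theorem 1 (ii) (p. 1185), §1 (p. 1184), §3 Proposition (pp. 1193–1197)] [cite: Shimura1998, §6.1 Corollary and §8.4 Example (1)] -/
theorem isIsogenous_iff_exists_unit_multiset_eq_of_dvd_of_dvd [IsCMField L] (hN2 : Nat.Coprime 2 N) (hN3 : Nat.Coprime 3 N)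
    {p : ℕ} (hp : p.Prime) (hp5 : 5 ≤ p) (hpN : p ∣ N) (hνp : p * p ∣ N ∨ 11 ≤ p)
    {q : ℕ} (hq : q.Prime) (hq5 : 5 ≤ q) (hqN : q ∣ N) (hνq : q * q ∣ N ∨ 11 ≤ q) {r s t r' s' t' : ZMod N}
    (hr : r ≠ 0) (hs : s ≠ 0) (ht : t ≠ 0) (hrst : r + s + t = 0) (hr' : r' ≠ 0) (hs' : s' ≠ 0) (ht' : t' ≠ 0) (hrst' : r' + s' + t' = 0)
    (hprim : ∀ q : ℕ, q.Prime → q ∣ N → ¬(q ∣ r.val ∧ q ∣ s.val ∧ q ∣ t.val))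
    (hprim' : ∀ q : ℕ, q.Prime → q ∣ N → ¬(q ∣ r'.val ∧ q ∣ s'.val ∧ q ∣ t'.val))
    (hpr : p ∣ r.val) (hqst : q ∣ s.val ∨ q ∣ t.val)
    (hS : IsCMResidueSet N (fermatCMType N r s t)) (hS' : IsCMResidueSet N (fermatCMType N r' s' t'))
    (hA : IsCMTypeRealisation (cmTypeOfResidues (L := L) (fermatCMType N r s t) hS.cm) A ι θ)
    (hA' : IsCMTypeRealisation (cmTypeOfResidues (L := L) (fermatCMType N r' s' t') hS'.cm) A' ι' θ') :
    AbelianVariety.IsIsogenous A A' ↔ ∃ u : ZMod N, IsUnit u ∧ ({r', s', t'} : Multiset (ZMod N)) = {u * r, u * s, u * t} := by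
  rw [isIsogenous_fermatCMType_iff_exists_eq_mul hS hS' hA hA']
  refine ⟨fun ⟨u, hu, hEq⟩ => ⟨u, hu, ?_⟩, fun ⟨u, hu, h⟩ => ⟨u, hu, fermatCMType_eq_of_multiset_eq h⟩⟩
  have hur : u * r ≠ 0 := fun h => hr (hu.mul_right_eq_zero.1 h)
  have hus : u * s ≠ 0 := fun h => hs (hu.mul_right_eq_zero.1 h)
  have hut : u * t ≠ 0 := fun h => ht (hu.mul_right_eq_zero.1 h)
  have hsum : u * r + u * s + u * t = 0 := by rw [← mul_add, ← mul_add, hrst, mul_zero]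
  have hprimu : ∀ q : ℕ, q.Prime → q ∣ N → ¬(q ∣ (u * r).val ∧ q ∣ (u * s).val ∧ q ∣ (u * t).val) := fun q hq hqN h =>
    hprim q hq hqN ⟨(dvd_val_mul_iff_of_isUnit_bt hqN hu r).1 h.1, (dvd_val_mul_iff_of_isUnit_bt hqN hu s).1 h.2.1,
      (dvd_val_mul_iff_of_isUnit_bt hqN hu t).1 h.2.2⟩
  exact (multiset_eq_of_fermatCMType_eq_of_dvd_of_dvd hN2 hN3 hp hp5 hpN hνp hq hq5 hqN hνq hur hus hut hsum hr' hs' ht' hrst' hprimu hprim'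
    hEq.symm ((dvd_val_mul_iff_of_isUnit_bt hpN hu r).2 hpr)
    (hqst.imp (fun h => (dvd_val_mul_iff_of_isUnit_bt hqN hu s).2 h) fun h => (dvd_val_mul_iff_of_isUnit_bt hqN hu t).2 h)).symm

end Varieties

/-! ## §7 The printed hypotheses: "g.c.d.`(r, s, t, r′, s′, t′) = 1`" (Case 1 makes both triples primitive); levels whose small primes occur squared -/

section Printed

variable {N : ℕ} [NeZero N]

omit [NeZero N] in
/-- Every prime divisor of an `N` prime to `6` is `≥ 5`. [folklore] -/
private theorem five_le_of_prime_dvd_bt (hN2 : Nat.Coprime 2 N) (hN3 : Nat.Coprime 3 N) {p : ℕ} (hp : p.Prime) (hpN : p ∣ N) :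
    5 ≤ p := by
  have h2 : p ≠ 2 := fun h => by rw [h] at hpN; exact absurd (Nat.Coprime.eq_one_of_dvd hN2 hpN) (by norm_num)
  have h3 : p ≠ 3 := fun h => by rw [h] at hpN; exact absurd (Nat.Coprime.eq_one_of_dvd hN3 hpN) (by norm_num)
  have h4 : p ≠ 4 := fun h => by rw [h] at hp; exact absurd hp (by decide)
  have := hp.two_le
  omega

/-- **Primitivity from "g.c.d.`(r, s, t, r′, s′, t′) = 1`"** (K–R's hypothesis, read on the primes of `N`: no prime of `N` divides all six
representatives): under `H_τ = H_{τ′}` at `N` prime to `6`, Case 1 (sibling `dvd_iff_dvd_of_fermatCMType_eq_of_prime_dvd`: a prime of `N`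
divides all of `r, s, t` iff it divides all of `r′, s′, t′`) makes BOTH triples primitive.
[cite: KoblitzRohrlich1978, §3 Proposition, Case 1 (pp. 1193–1195)] -/
theorem primitive_of_fermatCMType_eq_of_gcd_six (hN2 : Nat.Coprime 2 N) (hN3 : Nat.Coprime 3 N) {r s t r' s' t' : ZMod N}
    (hr : r ≠ 0) (hs : s ≠ 0) (ht : t ≠ 0) (hrst : r + s + t = 0) (hr' : r' ≠ 0) (hs' : s' ≠ 0) (ht' : t' ≠ 0) (hrst' : r' + s' + t' = 0)
    (hsix : ∀ q : ℕ, q.Prime → q ∣ N → ¬(q ∣ r.val ∧ q ∣ s.val ∧ q ∣ t.val ∧ q ∣ r'.val ∧ q ∣ s'.val ∧ q ∣ t'.val))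
    (hEq : fermatCMType N r s t = fermatCMType N r' s' t') :
    (∀ q : ℕ, q.Prime → q ∣ N → ¬(q ∣ r.val ∧ q ∣ s.val ∧ q ∣ t.val)) ∧
      (∀ q : ℕ, q.Prime → q ∣ N → ¬(q ∣ r'.val ∧ q ∣ s'.val ∧ q ∣ t'.val)) := by
  refine ⟨fun q hq hqN h => hsix q hq hqN ⟨h.1, h.2.1, h.2.2, ?_⟩, fun q hq hqN h => hsix q hq hqN ?_⟩
  · exact (dvd_iff_dvd_of_fermatCMType_eq_of_prime_dvd hN2 hN3 hr hs ht hrst hr' hs' ht' hrst' hEq hq hqN).1 h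
  · have h' := (dvd_iff_dvd_of_fermatCMType_eq_of_prime_dvd hN2 hN3 hr hs ht hrst hr' hs' ht' hrst' hEq hq hqN).2 h
    exact ⟨h'.1, h'.2.1, h'.2.2, h.1, h.2.1, h.2.2⟩

/-- **§3 PROPOSITION WITH ITS PRINTED HYPOTHESES, in the regimes**: `2, 3 ∤ N`; `τ = (r,s,t)`, `τ′ = (r′,s′,t′)` admissible (entries
non-zero, `r + s + t = 0 = r′ + s′ + t′` mod `N`); "g.c.d.`(r, s, t, r′, s′, t′) = 1`" (no prime of `N` divides all six representatives);
"`N` is not prime to `rstr′s′t′`": a prime `p ∣ N` with `p² ∣ N` or `p ≥ 11` divides `⟨r⟩` (w.l.o.g., by the symmetry of the statement in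
`τ, τ′` and under permutations); "in the case that `r = r′` …, `N` is not prime to `sts′t′`": a prime `q ∣ N` with `q² ∣ N` or `q ≥ 11`
divides `⟨s⟩` or `⟨t⟩`; "`H_τ = H_{τ′}`".  THEN "`τ′` is a permutation of `τ`": `{r, s, t} = {r′, s′, t′}`.
[cite: KoblitzRohrlich1978, §3 Proposition (p. 1193), Cases 1–3 (pp. 1193–1197)] -/
theorem multiset_eq_of_fermatCMType_eq_of_gcd_six (hN2 : Nat.Coprime 2 N) (hN3 : Nat.Coprime 3 N)
    {p : ℕ} (hp : p.Prime) (hpN : p ∣ N) (hνp : p * p ∣ N ∨ 11 ≤ p) {q : ℕ} (hq : q.Prime) (hqN : q ∣ N) (hνq : q * q ∣ N ∨ 11 ≤ q)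
    {r s t r' s' t' : ZMod N} (hr : r ≠ 0) (hs : s ≠ 0) (ht : t ≠ 0) (hrst : r + s + t = 0)
    (hr' : r' ≠ 0) (hs' : s' ≠ 0) (ht' : t' ≠ 0) (hrst' : r' + s' + t' = 0)
    (hsix : ∀ q : ℕ, q.Prime → q ∣ N → ¬(q ∣ r.val ∧ q ∣ s.val ∧ q ∣ t.val ∧ q ∣ r'.val ∧ q ∣ s'.val ∧ q ∣ t'.val))
    (hpr : p ∣ r.val) (hqst : q ∣ s.val ∨ q ∣ t.val) (hEq : fermatCMType N r s t = fermatCMType N r' s' t') :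
    ({r, s, t} : Multiset (ZMod N)) = {r', s', t'} := by
  obtain ⟨hprim, hprim'⟩ := primitive_of_fermatCMType_eq_of_gcd_six hN2 hN3 hr hs ht hrst hr' hs' ht' hrst' hsix hEq
  exact multiset_eq_of_fermatCMType_eq_of_dvd_of_dvd hN2 hN3 hp (five_le_of_prime_dvd_bt hN2 hN3 hp hpN) hpN hνp hq
    (five_le_of_prime_dvd_bt hN2 hN3 hq hqN) hqN hνq hr hs ht hrst hr' hs' ht' hrst' hprim hprim' hEq hpr hqst

/-- **THE PROPOSITION AT LEVELS WHOSE PRIMES `< 11` OCCUR SQUARED** (every boundary prime is then in a regime of this file): let `N` be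
prime to `6` with `p² ∣ N` for each prime `p ∣ N` with `p < 11` (i.e. `p ∈ {5, 7}`).  For admissible `τ, τ′` with no prime of `N`
dividing all six representatives, `H_τ = H_{τ′}`, a prime of `N` dividing `⟨r⟩` and a prime of `N` dividing `⟨s⟩` or `⟨t⟩`:
`{r, s, t} = {r′, s′, t′}`. [cite: KoblitzRohrlich1978, §3 Proposition (p. 1193), Cases 1–3 (pp. 1193–1197)] -/
theorem multiset_eq_of_fermatCMType_eq_of_sq_dvd_of_lt (hN2 : Nat.Coprime 2 N) (hN3 : Nat.Coprime 3 N)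
    (hreg : ∀ p : ℕ, p.Prime → p ∣ N → p < 11 → p * p ∣ N) {p : ℕ} (hp : p.Prime) (hpN : p ∣ N) {q : ℕ} (hq : q.Prime) (hqN : q ∣ N)
    {r s t r' s' t' : ZMod N} (hr : r ≠ 0) (hs : s ≠ 0) (ht : t ≠ 0) (hrst : r + s + t = 0)
    (hr' : r' ≠ 0) (hs' : s' ≠ 0) (ht' : t' ≠ 0) (hrst' : r' + s' + t' = 0)
    (hsix : ∀ q : ℕ, q.Prime → q ∣ N → ¬(q ∣ r.val ∧ q ∣ s.val ∧ q ∣ t.val ∧ q ∣ r'.val ∧ q ∣ s'.val ∧ q ∣ t'.val))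
    (hpr : p ∣ r.val) (hqst : q ∣ s.val ∨ q ∣ t.val) (hEq : fermatCMType N r s t = fermatCMType N r' s' t') :
    ({r, s, t} : Multiset (ZMod N)) = {r', s', t'} := by
  have hν : ∀ p : ℕ, p.Prime → p ∣ N → p * p ∣ N ∨ 11 ≤ p := fun p hp hpN => by
    rcases Nat.lt_or_ge p 11 with h | h
    · exact Or.inl (hreg p hp hpN h)
    · exact Or.inr h
  exact multiset_eq_of_fermatCMType_eq_of_gcd_six hN2 hN3 hp hpN (hν p hp hpN) hq hqN (hν q hq hqN) hr hs ht hrst hr' hs' ht' hrst'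
    hsix hpr hqst hEq

end Printed

/-! ## §8 CASE 3 AT `p = 7`, COMPLETE: the re-dispatch "`p = 7, a = 5`" on the primes of `g.c.d.(N, r)` and `N = 35` "by hand" -/

section Seven

variable {Q : ℕ} [NeZero (7 * Q)]

/-- **CASE 3 AT `p = 7` AT EVERY LEVEL `N = 7Q` PRIME TO `6`** ("It remains to consider the case `p = 7, a = 5` and the case `p = 5`. …
First suppose `p = 7, a = 5`. If a prime `q > 7` divides `r`, we can use Case 1, 2, or 3 with `p = q > 7` instead of `p = 7`. If `5 | r`,
so that `5² | N`, we can use Case 1, 2, or 3 with `p = 5, ν = 0`. The only remaining case when `p = 7, a = 5, 7² ∤ N` is when `r = 7`,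
i.e., `N = 35`; this case is easily checked by hand", p. 1197): for admissible primitive `τ, τ′` (all six entries non-zero), `7 ∣ ⟨r⟩` and
`7 ∤ ⟨r′⟩, ⟨s′⟩, ⟨t′⟩` force **`H_τ ≠ H_{τ′}`** — with `g = g.c.d.(N, ⟨r⟩)` and `a = N/g`: `a ≥ 7` is §3 (`…_or_gcd`); `a = 5`: a prime
`q ≥ 11` of `g` or `5 ∣ g` (then `5² ∣ N`) puts `r` among `r′, s′, t′` by §5 at `q`, resp. at `5` with `ν = 0`, contradicting `7 ∤ r′s′t′`;
`7² ∣ g` is §3 with `ν = 0`; otherwise `g = 7`, `N = 35`, where the tree's kernel enumeration `multiset_eq_of_fermatCMType_eq_thirtyFive`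
(gen 36; `τ′` has a unit entry by primitivity) replaces "checked by hand". [cite: KoblitzRohrlich1978, §3 Proposition, Case 3 (p. 1197)] -/
theorem fermatCMType_ne_of_seven_dvd_of_not_dvd (hN2 : Nat.Coprime 2 (7 * Q)) (hN3 : Nat.Coprime 3 (7 * Q))
    {r s t r' s' t' : ZMod (7 * Q)} (hr : r ≠ 0) (hs : s ≠ 0) (ht : t ≠ 0) (hrst : r + s + t = 0)
    (hr' : r' ≠ 0) (hs' : s' ≠ 0) (ht' : t' ≠ 0) (hrst' : r' + s' + t' = 0)
    (hprim : ∀ q : ℕ, q.Prime → q ∣ 7 * Q → ¬(q ∣ r.val ∧ q ∣ s.val ∧ q ∣ t.val))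
    (hprim' : ∀ q : ℕ, q.Prime → q ∣ 7 * Q → ¬(q ∣ r'.val ∧ q ∣ s'.val ∧ q ∣ t'.val))
    (h7r : 7 ∣ r.val) (h7r' : ¬7 ∣ r'.val) (h7s' : ¬7 ∣ s'.val) (h7t' : ¬7 ∣ t'.val) :
    fermatCMType (7 * Q) r s t ≠ fermatCMType (7 * Q) r' s' t' := by
  intro hEq
  have h7 : (7 : ℕ).Prime := by norm_num
  have h5 : (5 : ℕ).Prime := by norm_num
  -- `r` is not among `r′, s′, t′` (it is divisible by `7`, they are not)
  have hnot : ¬(r = r' ∨ r = s' ∨ r = t') := by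
    rintro (h | h | h)
    · exact h7r' (h ▸ h7r)
    · exact h7s' (h ▸ h7r)
    · exact h7t' (h ▸ h7r)
  -- `g = g.c.d.(N, r)`, `a = N/g ≥ 5`
  set g := Nat.gcd r.val (7 * Q) with hg
  have hrpos : 0 < r.val := Nat.pos_of_ne_zero fun h => hr ((ZMod.val_eq_zero r).1 h)
  have hg0 : 0 < g := Nat.gcd_pos_of_pos_left _ hrpos
  have h5g : 5 * g ≤ 7 * Q := five_mul_gcd_val_le hN2 hN3 hr
  have h7g : 7 ∣ g := Nat.dvd_gcd h7r (dvd_mul_right 7 Q)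
  obtain ⟨a, ha⟩ : g ∣ 7 * Q := Nat.gcd_dvd_right _ _
  by_cases hA : 7 * g ≤ 7 * Q
  · -- `a ≥ 7`
    exact fermatCMType_ne_of_dvd_of_not_dvd_of_sq_dvd_or_le_or_gcd h7 (by norm_num) hN2 hN3 (Or.inr (Or.inr ⟨le_rfl, hA⟩)) hr hrst
      hr' hrst' hprim hprim' h7r h7r' h7s' h7t' hEq
  -- `a = 5`, i.e. `N = 5g`
  have ha5 : 7 * Q = 5 * g := by
    have hlt : g * a < g * 7 := by rw [← ha]; linarith
    have hge : g * 5 ≤ g * a := by rw [← ha]; linarith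
    have ha7 : a < 7 := Nat.lt_of_mul_lt_mul_left hlt
    have ha5 : 5 ≤ a := Nat.le_of_mul_le_mul_left hge hg0
    interval_cases a
    · rw [ha, mul_comm]
    · exact absurd (Nat.Coprime.eq_one_of_dvd hN2 ⟨g * 3, by rw [ha]; ring⟩) (by norm_num)
  by_cases hbig : ∃ q : ℕ, q.Prime ∧ q ∣ g ∧ 11 ≤ q
  · -- "If a prime `q > 7` divides `r`, we can use Case 1, 2, or 3 with `p = q > 7`"
    obtain ⟨q, hq, hqg, hq11⟩ := hbig
    exact hnot (eq_or_eq_or_eq_of_fermatCMType_eq_of_dvd_level hq (by omega) (dvd_trans hqg (Nat.gcd_dvd_right _ _)) (Or.inr hq11)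
      hN2 hN3 hr hrst hr' hs' ht' hrst' hprim hprim' (dvd_trans hqg (Nat.gcd_dvd_left _ _)) hEq)
  by_cases h5g' : 5 ∣ g
  · -- "If `5 | r`, so that `5² | N`, we can use Case 1, 2, or 3 with `p = 5, ν = 0`"
    have h25 : 5 * 5 ∣ 7 * Q := by rw [ha5]; exact Nat.mul_dvd_mul_left 5 h5g'
    exact hnot (eq_or_eq_or_eq_of_fermatCMType_eq_of_dvd_level h5 le_rfl (dvd_trans h5g' (Nat.gcd_dvd_right _ _)) (Or.inl h25)
      hN2 hN3 hr hrst hr' hs' ht' hrst' hprim hprim' (dvd_trans h5g' (Nat.gcd_dvd_left _ _)) hEq)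
  by_cases h49 : 7 * 7 ∣ g
  · -- `7² ∣ N`: Case 3 with `ν = 0`
    have h7Q : 7 ∣ Q := (Nat.mul_dvd_mul_iff_left (by norm_num : 0 < 7)).1 (dvd_trans h49 (Nat.gcd_dvd_right _ _))
    exact fermatCMType_ne_of_dvd_of_not_dvd_of_sq_dvd_or_le h7 (by norm_num) (Or.inl h7Q) hN2 hN3 hr hrst hr' hrst' hprim hprim'
      h7r h7r' h7s' h7t' hEq
  -- "The only remaining case … is when `r = 7`, i.e., `N = 35`"
  obtain ⟨m, hm⟩ := h7g
  have hm1 : m = 1 := by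
    refine Nat.eq_one_iff_not_exists_prime_dvd.2 fun q hq hqm => ?_
    have hqg : q ∣ g := by rw [hm]; exact dvd_mul_of_dvd_right hqm 7
    have hqN : q ∣ 7 * Q := dvd_trans hqg (Nat.gcd_dvd_right _ _)
    have hq2 : q ≠ 2 := fun h => by rw [h] at hqN; exact absurd (Nat.Coprime.eq_one_of_dvd hN2 hqN) (by norm_num)
    have hq3 : q ≠ 3 := fun h => by rw [h] at hqN; exact absurd (Nat.Coprime.eq_one_of_dvd hN3 hqN) (by norm_num)
    have hq5 : q ≠ 5 := fun h => h5g' (h ▸ hqg)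
    have hq7 : q ≠ 7 := fun h => h49 (by rw [hm]; exact Nat.mul_dvd_mul_left 7 (h ▸ hqm))
    have hq11 : q < 11 := by by_contra h11; exact hbig ⟨q, hq, hqg, by omega⟩
    have hq2' := hq.two_le
    interval_cases q <;> first | omega | exact absurd hq (by norm_num)
  have hQ5 : Q = 5 := by rw [hm, hm1] at ha5; omega
  subst hQ5
  -- at `N = 35`: `τ′` has a unit entry (primitivity at `5`), and the tree's enumeration makes `τ′` a permutation of `τ`
  have hu : ∀ x : ZMod (7 * 5), ¬7 ∣ x.val → ¬5 ∣ x.val → IsUnit x := fun x h7x h5x =>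
    (isUnit_iff_val_coprime_bt x).2
      (Nat.Coprime.mul_right ((Nat.Prime.coprime_iff_not_dvd h7).2 h7x).symm ((Nat.Prime.coprime_iff_not_dvd h5).2 h5x).symm)
  have hunit : IsUnit r' ∨ IsUnit s' ∨ IsUnit t' := by
    by_contra hno
    push Not at hno
    have h5d : ∀ x : ZMod (7 * 5), ¬7 ∣ x.val → ¬IsUnit x → 5 ∣ x.val := fun x h7x hx => by_contra fun h5x => hx (hu x h7x h5x)
    exact hprim' 5 h5 (dvd_mul_left 5 7) ⟨h5d r' h7r' hno.1, h5d s' h7s' hno.2.1, h5d t' h7t' hno.2.2⟩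
  have hm35 : ({r', s', t'} : Multiset (ZMod (7 * 5))) = {r, s, t} :=
    multiset_eq_of_fermatCMType_eq_thirtyFive hr hs ht hrst hr' hs' ht' hrst' (Or.inr (Or.inr (Or.inr hunit))) hEq.symm
  have hmem : r ∈ ({r', s', t'} : Multiset (ZMod (7 * 5))) := by rw [hm35]; simp
  simp only [Multiset.insert_eq_cons, Multiset.mem_cons, Multiset.mem_singleton] at hmem
  exact hnot hmem

/-- **Case 3 at `p = 7`, general-level form**: `N` prime to `6`, `7 ∣ N`, admissible primitive `τ, τ′`, `7 ∣ ⟨r⟩`, `7 ∤ ⟨r′⟩, ⟨s′⟩, ⟨t′⟩`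
⟹ `H_τ ≠ H_{τ′}`. [cite: KoblitzRohrlich1978, §3 Proposition, Case 3 (pp. 1196–1197)] -/
theorem fermatCMType_ne_of_seven_dvd_of_not_dvd_level {N : ℕ} [NeZero N] (hN2 : Nat.Coprime 2 N) (hN3 : Nat.Coprime 3 N) (h7N : 7 ∣ N)
    {r s t r' s' t' : ZMod N} (hr : r ≠ 0) (hs : s ≠ 0) (ht : t ≠ 0) (hrst : r + s + t = 0)
    (hr' : r' ≠ 0) (hs' : s' ≠ 0) (ht' : t' ≠ 0) (hrst' : r' + s' + t' = 0)
    (hprim : ∀ q : ℕ, q.Prime → q ∣ N → ¬(q ∣ r.val ∧ q ∣ s.val ∧ q ∣ t.val))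
    (hprim' : ∀ q : ℕ, q.Prime → q ∣ N → ¬(q ∣ r'.val ∧ q ∣ s'.val ∧ q ∣ t'.val))
    (h7r : 7 ∣ r.val) (h7r' : ¬7 ∣ r'.val) (h7s' : ¬7 ∣ s'.val) (h7t' : ¬7 ∣ t'.val) :
    fermatCMType N r s t ≠ fermatCMType N r' s' t' := by
  obtain ⟨Q, rfl⟩ := h7N
  exact fermatCMType_ne_of_seven_dvd_of_not_dvd hN2 hN3 hr hs ht hrst hr' hs' ht' hrst' hprim hprim' h7r h7r' h7s' h7t'

end Seven

/-! ## §9 CASE 2 for every `p ≥ 7` off the residue class `r ≡ r′ (mod N/5)`: the unit `u` with `⟨u(r − r′)⟩ = ((y−1)/2)·(N/y)` -/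

section Half

variable {N : ℕ} [NeZero N]

/-- **A unit multiple just below `N/2`**: for `N` prime to `6` and `x ≠ 0` with `y = N/g.c.d.(⟨x⟩, N) ≠ 5` (hence `y ≥ 7`), there is a
unit `u` with `⟨ux⟩ = ((y − 1)/2)·(N/y)`, so that `3N/7 ≤ ⟨ux⟩ ≤ N/2` (our replacement, for `p ≥ 7`, of K–R's omitted LEMMA "there exists
`u ∈ (ℤ/Nℤ)*` such that `|⌊⟨ux⟩/(N/p)⌋ − ⌊⟨uy⟩/(N/p)⌋| ≥ 3` if `p > 5`", p. 1195; unit lifting `(ℤ/N)ˣ ↠ (ℤ/y)ˣ` is Mathlib's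
`ZMod.unitsMap_surjective`). [cite: KoblitzRohrlich1978, §3 Case 2, Lemma (p. 1195)] -/
theorem exists_isUnit_val_mul_near_half (hN2 : Nat.Coprime 2 N) (hN3 : Nat.Coprime 3 N) {x : ZMod N} (hx : x ≠ 0)
    (h5 : 5 * Nat.gcd x.val N ≠ N) : ∃ u : ZMod N, IsUnit u ∧ 3 * N ≤ 7 * (u * x).val ∧ 2 * (u * x).val ≤ N := by
  have hN0 : 0 < N := Nat.pos_of_ne_zero (NeZero.ne N)
  obtain ⟨u₁, hu₁, hg⟩ := exists_isUnit_val_mul_eq_gcd hx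
  have h5g := five_mul_gcd_val_le hN2 hN3 hx
  set g := Nat.gcd x.val N with hgdef
  have ha0 : 0 < x.val := Nat.pos_of_ne_zero fun h => hx ((ZMod.val_eq_zero x).1 h)
  have hg0 : 0 < g := Nat.gcd_pos_of_pos_left N ha0
  obtain ⟨y, hyN⟩ : g ∣ N := Nat.gcd_dvd_right x.val N
  have hyd : y ∣ N := ⟨g, by rw [hyN, mul_comm]⟩
  have hy2 : ¬2 ∣ y := fun h => by
    have := Nat.Coprime.eq_one_of_dvd (Nat.Coprime.coprime_dvd_right hyd hN2) h; omega
  obtain ⟨k, rfl⟩ : ∃ k, y = 2 * k + 1 := ⟨y / 2, by omega⟩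
  have hk5 : 5 ≤ 2 * k + 1 := Nat.le_of_mul_le_mul_left (by rw [← hyN]; linarith) hg0
  have hk3 : 3 ≤ k := by
    rcases Nat.lt_or_ge k 3 with h | h
    · exfalso; apply h5; rw [hyN]; have : k = 2 := by omega
      rw [this]
      ring
    · exact h
  have hcop : Nat.Coprime k (2 * k + 1) := (Nat.coprime_mul_right_add_right k 1 2).2 (Nat.coprime_one_right k)
  haveI : NeZero (2 * k + 1) := ⟨by omega⟩
  obtain ⟨U, hU⟩ := ZMod.unitsMap_surjective hyd (ZMod.unitOfCoprime k hcop)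
  have hUv : ZMod.castHom hyd (ZMod (2 * k + 1)) (U : ZMod N) = ((ZMod.unitOfCoprime k hcop : (ZMod (2 * k + 1))ˣ) : ZMod (2 * k + 1)) := by
    rw [← hU]; rfl
  rw [ZMod.coe_unitOfCoprime] at hUv
  have hmod : (U : ZMod N).val ≡ k [MOD 2 * k + 1] := by
    rw [← ZMod.natCast_eq_natCast_iff, ← hUv, ZMod.castHom_apply, ZMod.cast_eq_val]
  have hUg : (U : ZMod N) * (u₁ * x) = ((k * g : ℕ) : ZMod N) := by
    have e : (U : ZMod N) * (u₁ * x) = (((U : ZMod N).val * g : ℕ) : ZMod N) := by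
      rw [Nat.cast_mul, ZMod.natCast_zmod_val, ← hg, ZMod.natCast_zmod_val]
    rw [e, ZMod.natCast_eq_natCast_iff]
    have := Nat.ModEq.mul_right' g hmod
    rwa [mul_comm (2 * k + 1) g, ← hyN] at this
  have hkg : k * g < N := by rw [hyN]; nlinarith
  refine ⟨U * u₁, U.isUnit.mul hu₁, ?_, ?_⟩ <;> rw [mul_assoc, hUg, ZMod.val_natCast, Nat.mod_eq_of_lt hkg]
  · rw [hyN]; have := Nat.mul_le_mul_left g hk3; nlinarith
  · rw [hyN]; nlinarith

end Half

section CaseTwoSeven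

variable {p Q : ℕ} [NeZero (p * Q)]

/-- **CASE 2 FOR EVERY `p ≥ 7` AT EVERY LEVEL, off `r ≡ r′ (mod N/5)`**: at `N = pQ` prime to `6`, `p ≥ 7` prime (any `ν`), for admissible
primitive `τ, τ′` with `H_τ = H_{τ′}`, `p ∣ ⟨r⟩`, `p ∣ ⟨r′⟩` and `N ≠ 5·g.c.d.(⟨r − r′⟩, N)` (automatic when `5 ∤ N`): **`r = r′`** — K–R's
(5)–(6) with the unit of `exists_isUnit_val_mul_near_half` (`3N/7 ≤ ⟨u(r − r′)⟩ ≤ N/2` separates `p⟨ur⟩` from `p⟨ur′⟩` by more than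
`νN + (slack)` for every `p ≥ 7`).  This covers K–R's "`p > 5`" use of their omitted Lemma except on the one residue class; `p = 5`
(their "`ν + 2 = 2` if `p = 5`" and the sub-case "`N = 5N₀`", p. 1196) is NOT covered. [cite: KoblitzRohrlich1978, §3 Proposition, Case 2 (pp. 1195–1196, (5)–(6))] -/
theorem eq_of_fermatCMType_eq_of_dvd_of_dvd_of_seven_le (hp : p.Prime) (hp7 : 7 ≤ p)
    (hN2 : Nat.Coprime 2 (p * Q)) (hN3 : Nat.Coprime 3 (p * Q)) {r s t r' s' t' : ZMod (p * Q)}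
    (hr : r ≠ 0) (hrst : r + s + t = 0) (hr' : r' ≠ 0) (hrst' : r' + s' + t' = 0)
    (hprim : ∀ q : ℕ, q.Prime → q ∣ p * Q → ¬(q ∣ r.val ∧ q ∣ s.val ∧ q ∣ t.val))
    (hprim' : ∀ q : ℕ, q.Prime → q ∣ p * Q → ¬(q ∣ r'.val ∧ q ∣ s'.val ∧ q ∣ t'.val))
    (hpr : p ∣ r.val) (hpr' : p ∣ r'.val) (h5 : 5 * Nat.gcd (r - r').val (p * Q) ≠ p * Q)
    (hEq : fermatCMType (p * Q) r s t = fermatCMType (p * Q) r' s' t') : r = r' := by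
  by_contra hne
  have hQ2 : 2 ≤ Q := two_le_of_dvd_val_bt hr hpr
  have hQ0 : 0 < Q := by omega
  have hN0 : 0 < p * Q := Nat.pos_of_ne_zero (NeZero.ne _)
  have hps : ¬p ∣ s.val := fun h => hprim p hp (dvd_mul_right p Q) ⟨hpr, h, (dvd_val_iff_of_add_eq_zero hrst hpr).1 h⟩
  have hpt : ¬p ∣ t.val := fun h => hps ((dvd_val_iff_of_add_eq_zero hrst hpr).2 h)
  have hps' : ¬p ∣ s'.val := fun h => hprim' p hp (dvd_mul_right p Q) ⟨hpr', h, (dvd_val_iff_of_add_eq_zero hrst' hpr').1 h⟩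
  have hpt' : ¬p ∣ t'.val := fun h => hps' ((dvd_val_iff_of_add_eq_zero hrst' hpr').2 h)
  -- the unit `u` with `3N/7 ≤ ⟨u(r − r′)⟩ ≤ N/2`
  obtain ⟨u, hu, hD1, hD2⟩ := exists_isUnit_val_mul_near_half hN2 hN3 (sub_ne_zero.2 hne) h5
  have hsplit : (u * r).val = (u * r').val + (u * (r - r')).val ∨
      (u * r).val + p * Q = (u * r').val + (u * (r - r')).val := by
    have e : u * r = u * r' + u * (r - r') := by ring
    rcases Nat.lt_or_ge ((u * r').val + (u * (r - r')).val) (p * Q) with h | h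
    · left; rw [e, ZMod.val_add_of_lt h]
    · right; rw [e]; exact (ZMod.val_add_val_of_le h).symm
  obtain ⟨E, E', hcmp, hE, -⟩ := orbit_sum_compare hp hr hrst hr' hrst' hprim hprim' hEq hu
  simp only [sum_add_distrib] at hcmp
  have hTr := sum_val_orbit_mul_of_dvd u r hpr
  have hTr' := sum_val_orbit_mul_of_dvd u r' hpr'
  have hTs := two_mul_sum_val_orbit_mul hp u s (not_dvd_val_mul_bt hp hu s hps)
  have hTt := two_mul_sum_val_orbit_mul hp u t (not_dvd_val_mul_bt hp hu t hpt)
  have hTs' := two_mul_sum_val_orbit_mul hp u s' (not_dvd_val_mul_bt hp hu s' hps')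
  have hTt' := two_mul_sum_val_orbit_mul hp u t' (not_dvd_val_mul_bt hp hu t' hpt')
  have hs₀ := mul_mod_add_le_bt (p := p) hQ0 (u * s).val
  have ht₀ := mul_mod_add_le_bt (p := p) hQ0 (u * t).val
  have hs₀' := mul_mod_add_le_bt (p := p) hQ0 (u * s').val
  have ht₀' := mul_mod_add_le_bt (p := p) hQ0 (u * t').val
  have h7 : 7 * (p * Q) ≤ p * (p * Q) := Nat.mul_le_mul_right _ hp7
  have hD1p := Nat.mul_le_mul_left p hD1
  have hD2p := Nat.mul_le_mul_left p hD2
  have hnn₁ := Nat.zero_le (p * ((u * s).val % Q))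
  have hnn₂ := Nat.zero_le (p * ((u * t).val % Q))
  have hnn₃ := Nat.zero_le (p * ((u * s').val % Q))
  have hnn₄ := Nat.zero_le (p * ((u * t').val % Q))
  rcases hsplit with e | e <;> have ep := congrArg (p * ·) e <;> simp only [Nat.mul_add] at ep <;>
    rcases hE with ⟨rfl, rfl⟩ | ⟨hE1, hE2, hE1', hE2'⟩ <;> linarith

end CaseTwoSeven

/-! ## §10 THE PROPOSITION AT EVERY LEVEL `N` PRIME TO `30` (no regime clause): every boundary prime is `≥ 7` -/

section Thirty

variable {p Q : ℕ} [NeZero (p * Q)]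

omit [NeZero (p * Q)] in
/-- Every prime divisor of an `N` prime to `30` is `≥ 7`. [folklore] -/
private theorem seven_le_of_prime_dvd_bt {n : ℕ} (hn2 : Nat.Coprime 2 n) (hn3 : Nat.Coprime 3 n) (hn5 : Nat.Coprime 5 n) {q : ℕ}
    (hq : q.Prime) (hqn : q ∣ n) : 7 ≤ q := by
  have h2 : q ≠ 2 := fun h => by rw [h] at hqn; exact absurd (Nat.Coprime.eq_one_of_dvd hn2 hqn) (by norm_num)
  have h3 : q ≠ 3 := fun h => by rw [h] at hqn; exact absurd (Nat.Coprime.eq_one_of_dvd hn3 hqn) (by norm_num)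
  have h5 : q ≠ 5 := fun h => by rw [h] at hqn; exact absurd (Nat.Coprime.eq_one_of_dvd hn5 hqn) (by norm_num)
  have h4 : q ≠ 4 := fun h => by rw [h] at hq; exact absurd hq (by decide)
  have h6 : q ≠ 6 := fun h => by rw [h] at hq; exact absurd hq (by decide)
  have := hq.two_le
  omega

omit [NeZero (p * Q)] in
/-- A prime `≥ 7` other than `7` is `≥ 11`. [folklore] -/
private theorem eleven_le_of_ne_seven_bt {q : ℕ} (hq : q.Prime) (hq7 : 7 ≤ q) (hne : q ≠ 7) : 11 ≤ q := by
  have h8 : q ≠ 8 := fun h => by rw [h] at hq; exact absurd hq (by decide)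
  have h9 : q ≠ 9 := fun h => by rw [h] at hq; exact absurd hq (by decide)
  have h10 : q ≠ 10 := fun h => by rw [h] at hq; exact absurd hq (by decide)
  omega

omit [NeZero (p * Q)] in
/-- For `N` prime to `5`, `5·g ≠ N`. [folklore] -/
private theorem five_mul_ne_bt {n g : ℕ} (hn5 : Nat.Coprime 5 n) : 5 * g ≠ n := fun h =>
  absurd (Nat.Coprime.eq_one_of_dvd hn5 ⟨g, h.symm⟩) (by norm_num)

/-- **A boundary entry matches, at every `N = pQ` prime to `30`** (no regime clause: `p ≥ 7` automatically; Case 3 at `p = 7` by §8, at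
`p ≥ 11` by §3; Case 2 by §9, the excluded residue class being empty as `5 ∤ N`): admissible primitive `τ, τ′`, `H_τ = H_{τ′}`, `p ∣ ⟨r⟩`
⟹ `r = r′ ∨ r = s′ ∨ r = t′`. [cite: KoblitzRohrlich1978, §3 Proposition, Cases 2–3 (pp. 1195–1197)] -/
theorem eq_or_eq_or_eq_of_fermatCMType_eq_of_dvd_coprime_thirty (hp : p.Prime) (hN2 : Nat.Coprime 2 (p * Q))
    (hN3 : Nat.Coprime 3 (p * Q)) (hN5 : Nat.Coprime 5 (p * Q)) {r s t r' s' t' : ZMod (p * Q)}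
    (hr : r ≠ 0) (hs : s ≠ 0) (ht : t ≠ 0) (hrst : r + s + t = 0) (hr' : r' ≠ 0) (hs' : s' ≠ 0) (ht' : t' ≠ 0) (hrst' : r' + s' + t' = 0)
    (hprim : ∀ q : ℕ, q.Prime → q ∣ p * Q → ¬(q ∣ r.val ∧ q ∣ s.val ∧ q ∣ t.val))
    (hprim' : ∀ q : ℕ, q.Prime → q ∣ p * Q → ¬(q ∣ r'.val ∧ q ∣ s'.val ∧ q ∣ t'.val))
    (hpr : p ∣ r.val) (hEq : fermatCMType (p * Q) r s t = fermatCMType (p * Q) r' s' t') : r = r' ∨ r = s' ∨ r = t' := by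
  have hp7 : 7 ≤ p := seven_le_of_prime_dvd_bt hN2 hN3 hN5 hp (dvd_mul_right p Q)
  by_cases h1 : p ∣ r'.val
  · exact Or.inl (eq_of_fermatCMType_eq_of_dvd_of_dvd_of_seven_le hp hp7 hN2 hN3 hr hrst hr' hrst' hprim hprim' hpr h1
      (five_mul_ne_bt hN5) hEq)
  by_cases h2 : p ∣ s'.val
  · exact Or.inr (Or.inl (eq_of_fermatCMType_eq_of_dvd_of_dvd_of_seven_le hp hp7 hN2 hN3 hr hrst hs'
      (by rw [add_comm s' r']; exact hrst') hprim (fun q hq hqN h => hprim' q hq hqN ⟨h.2.1, h.1, h.2.2⟩) hpr h2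
      (five_mul_ne_bt hN5) (hEq.trans (fermatCMType_swap₁₂_bt r' s' t'))))
  by_cases h3 : p ∣ t'.val
  · exact Or.inr (Or.inr (eq_of_fermatCMType_eq_of_dvd_of_dvd_of_seven_le hp hp7 hN2 hN3 hr hrst ht'
      (by rw [show t' + s' + r' = r' + s' + t' by ring]; exact hrst') hprim (fun q hq hqN h => hprim' q hq hqN ⟨h.2.2, h.2.1, h.1⟩)
      hpr h3 (five_mul_ne_bt hN5) (hEq.trans (fermatCMType_swap₁₃_bt r' s' t'))))
  exfalso
  by_cases hp7' : p = 7
  · subst hp7'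
    exact fermatCMType_ne_of_seven_dvd_of_not_dvd hN2 hN3 hr hs ht hrst hr' hs' ht' hrst' hprim hprim' hpr h1 h2 h3 hEq
  · exact fermatCMType_ne_of_dvd_of_not_dvd_of_sq_dvd_or_le hp (by omega) (Or.inr (eleven_le_of_ne_seven_bt hp hp7 hp7')) hN2 hN3
      hr hrst hr' hrst' hprim hprim' hpr h1 h2 h3 hEq

/-- General-level form of the preceding: `N` prime to `30`, `p ∣ N` prime, `p ∣ ⟨r⟩` ⟹ `r ∈ {r′, s′, t′}`.
[cite: KoblitzRohrlich1978, §3 Proposition, Cases 2–3 (pp. 1195–1197)] -/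
theorem eq_or_eq_or_eq_of_fermatCMType_eq_of_dvd_coprime_thirty_level {N : ℕ} [NeZero N] {p : ℕ} (hp : p.Prime) (hpN : p ∣ N)
    (hN2 : Nat.Coprime 2 N) (hN3 : Nat.Coprime 3 N) (hN5 : Nat.Coprime 5 N) {r s t r' s' t' : ZMod N}
    (hr : r ≠ 0) (hs : s ≠ 0) (ht : t ≠ 0) (hrst : r + s + t = 0) (hr' : r' ≠ 0) (hs' : s' ≠ 0) (ht' : t' ≠ 0) (hrst' : r' + s' + t' = 0)
    (hprim : ∀ q : ℕ, q.Prime → q ∣ N → ¬(q ∣ r.val ∧ q ∣ s.val ∧ q ∣ t.val))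
    (hprim' : ∀ q : ℕ, q.Prime → q ∣ N → ¬(q ∣ r'.val ∧ q ∣ s'.val ∧ q ∣ t'.val))
    (hpr : p ∣ r.val) (hEq : fermatCMType N r s t = fermatCMType N r' s' t') : r = r' ∨ r = s' ∨ r = t' := by
  obtain ⟨Q, rfl⟩ := hpN
  exact eq_or_eq_or_eq_of_fermatCMType_eq_of_dvd_coprime_thirty hp hN2 hN3 hN5 hr hs ht hrst hr' hs' ht' hrst' hprim hprim' hpr hEq

/-- The matched form at `N` prime to `30`: `r = r′` and a prime `p ∣ N` dividing `⟨s⟩` ⟹ `{r, s, t} = {r′, s′, t′}`.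
[cite: KoblitzRohrlich1978, §3 Proposition (p. 1193), Cases 2–3 (pp. 1195–1197)] -/
theorem multiset_eq_of_fermatCMType_eq_of_eq_of_dvd_coprime_thirty_level {N : ℕ} [NeZero N] {p : ℕ} (hp : p.Prime) (hpN : p ∣ N)
    (hN2 : Nat.Coprime 2 N) (hN3 : Nat.Coprime 3 N) (hN5 : Nat.Coprime 5 N) {r s t r' s' t' : ZMod N}
    (hr : r ≠ 0) (hs : s ≠ 0) (ht : t ≠ 0) (hrst : r + s + t = 0) (hr' : r' ≠ 0) (hs' : s' ≠ 0) (ht' : t' ≠ 0) (hrst' : r' + s' + t' = 0)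
    (hprim : ∀ q : ℕ, q.Prime → q ∣ N → ¬(q ∣ r.val ∧ q ∣ s.val ∧ q ∣ t.val))
    (hprim' : ∀ q : ℕ, q.Prime → q ∣ N → ¬(q ∣ r'.val ∧ q ∣ s'.val ∧ q ∣ t'.val))
    (hEq : fermatCMType N r s t = fermatCMType N r' s' t') (hrr' : r = r') (hps : p ∣ s.val) :
    ({r, s, t} : Multiset (ZMod N)) = {r', s', t'} := by
  have hstr : s + t + r = 0 := by rw [show s + t + r = r + s + t by ring]; exact hrst
  have hEq₁ : fermatCMType N s t r = fermatCMType N r' s' t' :=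
    ((fermatCMType_swap₁₃_bt s t r).trans (fermatCMType_swap₂₃_bt r t s)).trans hEq
  rcases eq_or_eq_or_eq_of_fermatCMType_eq_of_dvd_coprime_thirty_level hp hpN hN2 hN3 hN5 hs ht hr hstr hr' hs' ht' hrst'
      (fun q hq hqN h => hprim q hq hqN ⟨h.2.2, h.1, h.2.1⟩) hprim' hps hEq₁ with h | h | h
  · have hpr : p ∣ r.val := by rw [hrr', ← h]; exact hps
    obtain ⟨Q, rfl⟩ := hpN
    exact absurd ⟨hpr, hps, (dvd_val_iff_of_add_eq_zero hrst hpr).1 hps⟩ (hprim p hp (dvd_mul_right p Q))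
  · subst hrr' h
    have htt' : t = t' := by linear_combination hrst - hrst'
    rw [htt']
  · subst hrr' h
    have hts' : t = s' := by linear_combination hrst - hrst'
    rw [hts', Multiset.pair_comm]

/-- **KOBLITZ–ROHRLICH §3 PROPOSITION AT EVERY LEVEL `N` PRIME TO `30`, NO REGIME CLAUSE**: for admissible primitive `τ, τ′` modulo `N`
(`N` prime to `2, 3, 5`) with `H_τ = H_{τ′}`, a prime of `N` dividing `⟨r⟩` ("`N` is not prime to `rstr′s′t′`") and a prime of `N` dividing
`⟨s⟩` or `⟨t⟩` ("… not prime to `sts′t′`"): **`{r, s, t} = {r′, s′, t′}`** — every prime of `N` is `≥ 7`, `p = 7` is §§8–9, `p ≥ 11` is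
§§3–4.  Only levels divisible by `5` (K–R's `p = 5` analysis and the class `r ≡ r′ (mod N/5)` at `p = 7`) remain outside the tree beyond the
regime `5² ∣ N` of §7. [cite: KoblitzRohrlich1978, §3 Proposition (p. 1193), Cases 1–3 (pp. 1193–1197)] -/
theorem multiset_eq_of_fermatCMType_eq_of_dvd_of_dvd_coprime_thirty {N : ℕ} [NeZero N] (hN2 : Nat.Coprime 2 N) (hN3 : Nat.Coprime 3 N)
    (hN5 : Nat.Coprime 5 N) {p : ℕ} (hp : p.Prime) (hpN : p ∣ N) {q : ℕ} (hq : q.Prime) (hqN : q ∣ N) {r s t r' s' t' : ZMod N}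
    (hr : r ≠ 0) (hs : s ≠ 0) (ht : t ≠ 0) (hrst : r + s + t = 0) (hr' : r' ≠ 0) (hs' : s' ≠ 0) (ht' : t' ≠ 0) (hrst' : r' + s' + t' = 0)
    (hprim : ∀ q : ℕ, q.Prime → q ∣ N → ¬(q ∣ r.val ∧ q ∣ s.val ∧ q ∣ t.val))
    (hprim' : ∀ q : ℕ, q.Prime → q ∣ N → ¬(q ∣ r'.val ∧ q ∣ s'.val ∧ q ∣ t'.val))
    (hEq : fermatCMType N r s t = fermatCMType N r' s' t') (hpr : p ∣ r.val) (hqst : q ∣ s.val ∨ q ∣ t.val) :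
    ({r, s, t} : Multiset (ZMod N)) = {r', s', t'} := by
  obtain ⟨r₁, s₁, t₁, hr₁, hs₁, ht₁, hrst₁, hprim₁, hEq', hperm, hrr₁⟩ : ∃ r₁ s₁ t₁ : ZMod N, r₁ ≠ 0 ∧ s₁ ≠ 0 ∧ t₁ ≠ 0 ∧
      r₁ + s₁ + t₁ = 0 ∧ (∀ q : ℕ, q.Prime → q ∣ N → ¬(q ∣ r₁.val ∧ q ∣ s₁.val ∧ q ∣ t₁.val)) ∧
      fermatCMType N r s t = fermatCMType N r₁ s₁ t₁ ∧ ({r₁, s₁, t₁} : Multiset (ZMod N)) = {r', s', t'} ∧ r = r₁ := by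
    rcases eq_or_eq_or_eq_of_fermatCMType_eq_of_dvd_coprime_thirty_level hp hpN hN2 hN3 hN5 hr hs ht hrst hr' hs' ht' hrst' hprim
      hprim' hpr hEq with h | h | h
    · exact ⟨r', s', t', hr', hs', ht', hrst', hprim', hEq, rfl, h⟩
    · exact ⟨s', r', t', hs', hr', ht', by rw [add_comm s' r']; exact hrst', fun q hq hqN h' => hprim' q hq hqN ⟨h'.2.1, h'.1, h'.2.2⟩,
        hEq.trans (fermatCMType_swap₁₂_bt r' s' t'), Multiset.cons_swap s' r' {t'}, h⟩
    · exact ⟨t', s', r', ht', hs', hr', by rw [show t' + s' + r' = r' + s' + t' by ring]; exact hrst',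
        fun q hq hqN h' => hprim' q hq hqN ⟨h'.2.2, h'.2.1, h'.1⟩, hEq.trans (fermatCMType_swap₁₃_bt r' s' t'),
        calc ({t', s', r'} : Multiset (ZMod N)) = {t', r', s'} := by rw [Multiset.pair_comm s' r']
          _ = {r', t', s'} := Multiset.cons_swap t' r' {s'}
          _ = {r', s', t'} := by rw [Multiset.pair_comm t' s'], h⟩
  rw [← hperm]
  rcases hqst with hqs | hqt
  · exact multiset_eq_of_fermatCMType_eq_of_eq_of_dvd_coprime_thirty_level hq hqN hN2 hN3 hN5 hr hs ht hrst hr₁ hs₁ ht₁ hrst₁ hprim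
      hprim₁ hEq' hrr₁ hqs
  · have h := multiset_eq_of_fermatCMType_eq_of_eq_of_dvd_coprime_thirty_level hq hqN hN2 hN3 hN5 hr ht hs
      (by rw [show r + t + s = r + s + t by ring]; exact hrst) hr₁ hs₁ ht₁ hrst₁ (fun q hq hqN h' => hprim q hq hqN ⟨h'.1, h'.2.2, h'.2.1⟩)
      hprim₁ ((fermatCMType_swap₂₃_bt r t s).trans hEq') hrr₁ hqt
    rw [← h, Multiset.pair_comm]

/-- **The Proposition with its printed hypotheses at every `N` prime to `30`**: "g.c.d.`(r, s, t, r′, s′, t′) = 1`" (no prime of `N` divides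
all six representatives), "`N` not prime to `rstr′s′t′`" (a prime of `N` divides `⟨r⟩`), "in the case `r = r′` …, `N` not prime to `sts′t′`"
(a prime of `N` divides `⟨s⟩` or `⟨t⟩`), `H_τ = H_{τ′}` ⟹ `{r, s, t} = {r′, s′, t′}`.
[cite: KoblitzRohrlich1978, §3 Proposition (p. 1193), Cases 1–3 (pp. 1193–1197)] -/
theorem multiset_eq_of_fermatCMType_eq_of_gcd_six_coprime_thirty {N : ℕ} [NeZero N] (hN2 : Nat.Coprime 2 N) (hN3 : Nat.Coprime 3 N)
    (hN5 : Nat.Coprime 5 N) {p : ℕ} (hp : p.Prime) (hpN : p ∣ N) {q : ℕ} (hq : q.Prime) (hqN : q ∣ N) {r s t r' s' t' : ZMod N}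
    (hr : r ≠ 0) (hs : s ≠ 0) (ht : t ≠ 0) (hrst : r + s + t = 0) (hr' : r' ≠ 0) (hs' : s' ≠ 0) (ht' : t' ≠ 0) (hrst' : r' + s' + t' = 0)
    (hsix : ∀ q : ℕ, q.Prime → q ∣ N → ¬(q ∣ r.val ∧ q ∣ s.val ∧ q ∣ t.val ∧ q ∣ r'.val ∧ q ∣ s'.val ∧ q ∣ t'.val))
    (hpr : p ∣ r.val) (hqst : q ∣ s.val ∨ q ∣ t.val) (hEq : fermatCMType N r s t = fermatCMType N r' s' t') :
    ({r, s, t} : Multiset (ZMod N)) = {r', s', t'} := by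
  obtain ⟨hprim, hprim'⟩ := primitive_of_fermatCMType_eq_of_gcd_six hN2 hN3 hr hs ht hrst hr' hs' ht' hrst' hsix hEq
  exact multiset_eq_of_fermatCMType_eq_of_dvd_of_dvd_coprime_thirty hN2 hN3 hN5 hp hpN hq hqN hr hs ht hrst hr' hs' ht' hrst' hprim hprim'
    hEq hpr hqst

open Literature.AlgebraicGeometry.Motives (AbelianVariety)
open Literature.AlgebraicGeometry.HodgeTheory (complexBetti)
open Literature.AlgebraicGeometry.Pohlmann1968.Cyclotomic (cmTypeOfResidues)
open CyclotomicCMTypeResidueSets (IsCMResidueSet)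
open NumberField

variable {N : ℕ} [NeZero N] {L : Type} [Field L] [NumberField L] [IsCyclotomicExtension {N} ℚ L]
  {A A' : AbelianVariety ℂ} {ι : 𝓞 L →+* CategoryTheory.End A} {θ : L →+* Module.End ℂ (complexBetti A.X 1)}
  {ι' : 𝓞 L →+* CategoryTheory.End A'} {θ' : L →+* Module.End ℂ (complexBetti A'.X 1)}

omit [NeZero (p * Q)] in
/-- **THEOREM 1 (ii) FOR BOUNDARY TRIPLES AT EVERY `N` PRIME TO `30`, ON ABELIAN VARIETIES**: realisations `A`, `A′` of the full-level
types `Φ_{H_τ}`, `Φ_{H_{τ′}}` of `ℚ(ζ_N)` (`τ, τ′` admissible primitive, a prime of `N` dividing `⟨r⟩`, a prime of `N` dividing `⟨s⟩` or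
`⟨t⟩`) are ISOGENOUS iff `{r′, s′, t′} = {ur, us, ut}` for a unit `u` ("the only isogenies … are the obvious equalities").
[cite: KoblitzRohrlich1978, Theorem 1 (ii) (p. 1185), §3 Proposition (pp. 1193–1197)] [cite: Shimura1998, §6.1 Corollary and §8.4 Example (1)] -/
theorem isIsogenous_iff_exists_unit_multiset_eq_coprime_thirty [IsCMField L] (hN2 : Nat.Coprime 2 N) (hN3 : Nat.Coprime 3 N)
    (hN5 : Nat.Coprime 5 N) {p : ℕ} (hp : p.Prime) (hpN : p ∣ N) {q : ℕ} (hq : q.Prime) (hqN : q ∣ N) {r s t r' s' t' : ZMod N}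
    (hr : r ≠ 0) (hs : s ≠ 0) (ht : t ≠ 0) (hrst : r + s + t = 0) (hr' : r' ≠ 0) (hs' : s' ≠ 0) (ht' : t' ≠ 0) (hrst' : r' + s' + t' = 0)
    (hprim : ∀ q : ℕ, q.Prime → q ∣ N → ¬(q ∣ r.val ∧ q ∣ s.val ∧ q ∣ t.val))
    (hprim' : ∀ q : ℕ, q.Prime → q ∣ N → ¬(q ∣ r'.val ∧ q ∣ s'.val ∧ q ∣ t'.val))
    (hpr : p ∣ r.val) (hqst : q ∣ s.val ∨ q ∣ t.val)
    (hS : IsCMResidueSet N (fermatCMType N r s t)) (hS' : IsCMResidueSet N (fermatCMType N r' s' t'))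
    (hA : IsCMTypeRealisation (cmTypeOfResidues (L := L) (fermatCMType N r s t) hS.cm) A ι θ)
    (hA' : IsCMTypeRealisation (cmTypeOfResidues (L := L) (fermatCMType N r' s' t') hS'.cm) A' ι' θ') :
    AbelianVariety.IsIsogenous A A' ↔ ∃ u : ZMod N, IsUnit u ∧ ({r', s', t'} : Multiset (ZMod N)) = {u * r, u * s, u * t} := by
  rw [isIsogenous_fermatCMType_iff_exists_eq_mul hS hS' hA hA']
  refine ⟨fun ⟨u, hu, hEq⟩ => ⟨u, hu, ?_⟩, fun ⟨u, hu, h⟩ => ⟨u, hu, fermatCMType_eq_of_multiset_eq h⟩⟩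
  have hur : u * r ≠ 0 := fun h => hr (hu.mul_right_eq_zero.1 h)
  have hus : u * s ≠ 0 := fun h => hs (hu.mul_right_eq_zero.1 h)
  have hut : u * t ≠ 0 := fun h => ht (hu.mul_right_eq_zero.1 h)
  have hsum : u * r + u * s + u * t = 0 := by rw [← mul_add, ← mul_add, hrst, mul_zero]
  have hprimu : ∀ q : ℕ, q.Prime → q ∣ N → ¬(q ∣ (u * r).val ∧ q ∣ (u * s).val ∧ q ∣ (u * t).val) := fun q hq hqN h =>
    hprim q hq hqN ⟨(dvd_val_mul_iff_of_isUnit_bt hqN hu r).1 h.1, (dvd_val_mul_iff_of_isUnit_bt hqN hu s).1 h.2.1,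
      (dvd_val_mul_iff_of_isUnit_bt hqN hu t).1 h.2.2⟩
  exact (multiset_eq_of_fermatCMType_eq_of_dvd_of_dvd_coprime_thirty hN2 hN3 hN5 hp hpN hq hqN hur hus hut hsum hr' hs' ht' hrst' hprimu
    hprim' hEq.symm ((dvd_val_mul_iff_of_isUnit_bt hpN hu r).2 hpr)
    (hqst.imp (fun h => (dvd_val_mul_iff_of_isUnit_bt hqN hu s).2 h) fun h => (dvd_val_mul_iff_of_isUnit_bt hqN hu t).2 h)).symm

end Thirty

end CyclotomicFermatCMType

end Literature.AlgebraicGeometry.ComplexMultiplication
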